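import Literature.Probability.RandomPlanarGeometry.SAWPolygonJoinSpec
import Literature.Probability.RandomPlanarGeometry.SAWPolygonExtremalVertices
import Mathlib.Combinatorics.SimpleGraph.Connectivity.Subgraph

/-!
# Madras' polygon join on `ℤ²`: the cap gadget (a local rule with a certified case table)

Topic `Literature/Probability/RandomPlanarGeometry` (continues `SAWPolygonJoinSpec.lean`: `CapHyp`, `CapSpec`, `CapGadget`;
`SAWPolygonSurgery.lean`:
`IsPolygon.exists_isPath_erase`).

Source.  N. Madras, J. Stat. Phys. 78 (1995) 681–699 [Madras1995LatticeAnimalsExponent], as recalled by A. Hammond,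
arXiv:1504.05286 [Hammond2015SAPJoining], §4.1 p. 18 (section and page numbers of arXiv v5, 2017, here and in every `[cite:]`
below): "Madras now defines a modified polygon `τ̃` [printed: `τ_mod`], which is formed from `τ`
by changing its structure in a neighbourhood of `Y ∈ ℤ²`.  Depending on the structure of `τ` near `Y`, either two edges are
removed and ten edges added to form `τ̃` from `τ`, or one edge is removed and nine are added.  As such, `τ̃` has length `n + 8`.
The rule that specifies `τ̃` is recalled from [Madras95] in Figure 2 [p. 19]", and, same page: "`τ̃` extends `τ` to the right
of `Y` by either two or three units inside the right corridor … `τ̃` contains two vertical edges that cross the right corridor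
at the maximal `x`-coordinate adopted by vertices in `τ̃` that lie in this corridor".

Madras' Figure-2 rule itself is an image not reproduced in the held text; this file proves the lane's abstraction `CapGadget`
(venture «pcv-sawmu», route MAD95-2JP, step S2; statement verbatim a-idea-2 Sketch_v6 v6.4) with its OWN rule, a nine-branch
case table on the pattern of `τ` at the six window sites `a = Y+e₂, b = Y, c = Y−e₂, L₊, L₀, L₋` (their left neighbours),
using three detour shapes `C7` (7 edges, extension 2), `C9std`, `C9alt` (9 edges, extension 3) — the lane's blueprint
(a-idea-2, ROUTES §33.5 / S2_BLUEPRINT), whose 162-pattern table was checked independently by two refuter seats; here the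
table enters only through nine explicit detour walks and small kernel `decide`s, and injectivity is proved structurally
(three corridor probe edges + the edges `aL₊`, `cL₋` determine the branch; the band-leaving vertical edge `a_up`/`c_dn`
excludes a unit horizontal offset between an extension-2 and an extension-3 image).  All proofs are ours.

## Contents (namespace `Literature.Probability.RandomPlanarGeometry.SAW.JoinParity`; 0 sorries)

* `AnchoredSpec`, `anchoredCap`, `anchoredExt`, **`capSpec_of_anchored`** (an origin-anchored rule commutes with translations);
* `polygon_deg_le_two`; single-strand rerouting `reroute_one`, `reroute_two`;
* the window at the origin (`sA`, …, `sLm`; `sB_not_vert`, `sA_edges`, `sC_edges`, `sL0_two`, `sLp_only`, `sLm_only`);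
* the rule: branches `Br`, detours `wAup`, …, `wG1d`, `br`, `cap₀`, `ext₀`, `BrFacts`, `br_spec`;
* the clauses `cap₀_isPolygon`, `ext₀_cases`, `cap₀_marked`, `cap₀_corridor`, `cap₀_window`; injectivity `inj_zero`,
  `no_shift_one`; `anchoredSpec_cap₀` and **`capGadget : CapGadget`**.
-/

noncomputable section

open Finset SimpleGraph Literature.Probability.LatticeModels Literature.Probability.Percolation
open Literature.Barriers.CriticalPhenomena.SupercriticalSAW (shiftEdges isPolygon_shiftEdges
  card_shiftEdges mem_shiftEdges_iff shiftEdges_injective)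
open Literature.Probability.Percolation.SiteGadgetSystem (vertsOf mem_vertsOf)
open Literature.Probability.RandomPlanarGeometry.SAW

namespace Literature.Probability.RandomPlanarGeometry.SAW.JoinParity

/-! ### Coordinates and translations (small kit, as in MAD95_JoinMap.lean) -/

/-- two sites of `ℤ²` are equal iff their coordinates are. [folklore] -/
private theorem site_ext_iff (x y : Site 2) : x = y ↔ x 0 = y 0 ∧ x 1 = y 1 :=
  ⟨fun h => by rw [h]; exact ⟨rfl, rfl⟩, fun h => by funext i; fin_cases i <;> simp [h.1, h.2]⟩

/-- `vec_zero'`. [folklore] -/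
@[simp] private theorem vec_zero' (a b : ℤ) : (![a, b] : Site 2) 0 = a := rfl
/-- `vec_one'`. [folklore] -/
@[simp] private theorem vec_one' (a b : ℤ) : (![a, b] : Site 2) 1 = b := rfl

/-- horizontal translation vector `(j, 0)`. [folklore] -/
private def xsh (j : ℤ) : Site 2 := ![j, 0]
/-- `xsh_zero`. [folklore] -/
@[simp] private theorem xsh_zero (j : ℤ) : xsh j 0 = j := rfl
/-- `xsh_one`. [folklore] -/
@[simp] private theorem xsh_one (j : ℤ) : xsh j 1 = 0 := rfl

/-- translation of an edge. [folklore] -/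
private abbrev shE (t : Site 2) (e : Sym2 (Site 2)) : Sym2 (Site 2) := Sym2.map (fun v => v + t) e

/-- `shE_injective`. [folklore] -/
private theorem shE_injective (t : Site 2) : Function.Injective (shE t) :=
  Sym2.map.injective (add_left_injective t)

/-- a translated edge lies in the translated set iff the edge lies in the set. [folklore] -/
private theorem mem_shiftEdges {t : Site 2} {E : Finset (Sym2 (Site 2))} {e : Sym2 (Site 2)} :
    shE t e ∈ shiftEdges t E ↔ e ∈ E := by
  rw [mem_shiftEdges_iff]
  constructor
  · rintro ⟨e', he', h⟩; rwa [← shE_injective t h]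
  · exact fun h => ⟨e, h, rfl⟩

/-- `shiftEdges_neg_shiftEdges`. [folklore] -/
private theorem shiftEdges_neg_shiftEdges (t : Site 2) (E : Finset (Sym2 (Site 2))) :
    shiftEdges (-t) (shiftEdges t E) = E := by
  rw [shiftEdges_shiftEdges, add_neg_cancel, shiftEdges_zero]

/-- `shiftEdges_shiftEdges_neg`. [folklore] -/
private theorem shiftEdges_shiftEdges_neg (t : Site 2) (E : Finset (Sym2 (Site 2))) :
    shiftEdges t (shiftEdges (-t) E) = E := by
  rw [shiftEdges_shiftEdges, neg_add_cancel, shiftEdges_zero]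

/-- the vertices of a translate are the translated vertices. [folklore] -/
private theorem vertsOf_shiftEdges (t : Site 2) (E : Finset (Sym2 (Site 2))) :
    vertsOf (shiftEdges t E) = (vertsOf E).image (fun v => v + t) := by
  ext v
  rw [mem_vertsOf_shiftEdges, Finset.mem_image]
  constructor
  · exact fun h => ⟨v - t, h, sub_add_cancel v t⟩
  · rintro ⟨w, hw, rfl⟩; rwa [add_sub_cancel_right]

/-- `CapHyp` is translation invariant. [folklore] -/
private theorem capHyp_shiftEdges {t Y : Site 2} {τ : Finset (Sym2 (Site 2))} :
    CapHyp (shiftEdges t τ) (Y + t) ↔ CapHyp τ Y := by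
  unfold CapHyp
  simp only [vertsOf_shiftEdges, Finset.mem_image, Pi.add_apply, forall_exists_index, and_imp,
    forall_apply_eq_imp_iff₂]
  constructor
  · rintro ⟨⟨_, ⟨s, hs, rfl⟩, h0, h1⟩, h⟩
    refine ⟨⟨s, hs, by simpa using h0, by simpa using h1⟩, fun v hv hlt => ?_⟩
    have := h v hv (by simpa using hlt)
    simpa using this
  · rintro ⟨⟨s, hs, h0, h1⟩, h⟩
    refine ⟨⟨s + t, ⟨s, hs, rfl⟩, by simpa using h0, by simpa using h1⟩, fun v hv hlt => ?_⟩
    have := h v hv (by simpa using hlt)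
    simpa using this

/-! ### (1) Origin-anchored rules satisfy `CapSpec` -/

/-- The clauses of `CapGadget` for a rule `cap₀` AT THE ORIGIN (`Y = 0`), plus the anchored form of the
injectivity clause: equal images up to the HORIZONTAL translation `d = ext₀ τ − ext₀ τ'` force `τ = τ' + (d,0)`
(for `d = 0` this is plain injectivity; `d = ±1` must be shown impossible). [cite: Hammond2015SAPJoining, §4.1 pp. 17–18 (the modification is defined relative to Y; arXiv v5)] -/
def AnchoredSpec (cap₀ : Finset (Sym2 (Site 2)) → Finset (Sym2 (Site 2))) (ext₀ : Finset (Sym2 (Site 2)) → ℤ) : Prop :=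
  (∀ τ, IsPolygon (zdGraph 2) τ → CapHyp τ 0 →
      IsPolygon (zdGraph 2) (cap₀ τ) ∧ (cap₀ τ).card = τ.card + 8 ∧ (ext₀ τ = 2 ∨ ext₀ τ = 3) ∧
      s((![ext₀ τ, -1] : Site 2), ![ext₀ τ, 0]) ∈ cap₀ τ ∧
      s((![ext₀ τ, 0] : Site 2), ![ext₀ τ, 1]) ∈ cap₀ τ ∧
      (∀ v ∈ vertsOf (cap₀ τ), |v 1| ≤ 1 → v 0 ≤ ext₀ τ) ∧
      (∀ e, (e ∈ cap₀ τ ↔ e ∈ τ) ∨ (∀ v ∈ (e : Sym2 (Site 2)).toFinset, -1 ≤ v 0 ∧ |v 1| ≤ 1))) ∧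
  (∀ τ τ' (d : ℤ), IsPolygon (zdGraph 2) τ → CapHyp τ 0 → IsPolygon (zdGraph 2) τ' → CapHyp τ' 0 →
      ext₀ τ = ext₀ τ' + d → cap₀ τ = shiftEdges (xsh d) (cap₀ τ') → τ = shiftEdges (xsh d) τ')

/-- the rule read relative to `Y`. [cite: Hammond2015SAPJoining, §4.1 pp. 17–18 (the modification is defined relative to Y; arXiv v5)] -/
def anchoredCap (cap₀ : Finset (Sym2 (Site 2)) → Finset (Sym2 (Site 2))) (τ : Finset (Sym2 (Site 2))) (Y : Site 2) :
    Finset (Sym2 (Site 2)) := shiftEdges Y (cap₀ (shiftEdges (-Y) τ))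

/-- the extension read relative to `Y`. [cite: Hammond2015SAPJoining, §4.1 pp. 17–18 (the modification is defined relative to Y; arXiv v5)] -/
def anchoredExt (ext₀ : Finset (Sym2 (Site 2)) → ℤ) (τ : Finset (Sym2 (Site 2))) (Y : Site 2) : ℤ :=
  ext₀ (shiftEdges (-Y) τ)

/-- `CapHyp τ Y` transported to the origin. [cite: Hammond2015SAPJoining, §4.1 pp. 17–18 (the modification is defined relative to Y; arXiv v5)] -/
private theorem capHyp_anchor {τ : Finset (Sym2 (Site 2))} {Y : Site 2} (h : CapHyp τ Y) : CapHyp (shiftEdges (-Y) τ) 0 := by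
  have : (0 : Site 2) = Y + -Y := by simp
  rw [this]; exact capHyp_shiftEdges.2 h

/-- **An origin-anchored rule satisfying `AnchoredSpec` satisfies `CapSpec` (v6.3).** [cite: Hammond2015SAPJoining, §4.1 pp. 17–18 (the modification is defined relative to Y; arXiv v5)] -/
theorem capSpec_of_anchored {cap₀ : Finset (Sym2 (Site 2)) → Finset (Sym2 (Site 2))}
    {ext₀ : Finset (Sym2 (Site 2)) → ℤ} (h : AnchoredSpec cap₀ ext₀) :
    CapSpec (anchoredCap cap₀) (anchoredExt ext₀) := by
  obtain ⟨h1, h2⟩ := h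
  refine ⟨fun τ Y hP hC => ?_, fun τ τ' Y Y' hP hC hP' hC' hrow hcol hcap => ?_, fun τ Y t _ _ => ?_⟩
  · -- the clauses, transported from the origin
    obtain ⟨q1, q2, q3, q4, q5, q6, q7⟩ := h1 (shiftEdges (-Y) τ) (isPolygon_shiftEdges hP _) (capHyp_anchor hC)
    refine ⟨isPolygon_shiftEdges q1 _, by rw [anchoredCap, card_shiftEdges, q2, card_shiftEdges], q3, ?_, ?_, ?_, ?_⟩
    · rw [anchoredCap, anchoredExt]
      convert (mem_shiftEdges (t := Y)).2 q4 using 1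
      simp only [Sym2.map_mk]
      congr 1 <;> (funext i; fin_cases i <;> simp <;> ring)
    · rw [anchoredCap, anchoredExt]
      convert (mem_shiftEdges (t := Y)).2 q5 using 1
      simp only [Sym2.map_mk]
      congr 1 <;> (funext i; fin_cases i <;> simp <;> ring)
    · intro v hv hrow
      rw [anchoredCap, mem_vertsOf_shiftEdges] at hv
      have := q6 _ hv (by simpa using hrow)
      rw [anchoredExt]; simp at this; linarith
    · intro e
      rcases q7 (shE (-Y) e) with h | h
      · left
        rw [anchoredCap, ← mem_shiftEdges (t := -Y), shiftEdges_neg_shiftEdges, h, mem_shiftEdges]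
      · right
        intro v hv
        have hv' : v + -Y ∈ (shE (-Y) e : Sym2 (Site 2)).toFinset := by
          rw [Sym2.mem_toFinset] at hv ⊢
          induction e using Sym2.ind with
          | _ a b =>
            simp only [Sym2.map_mk, Sym2.mem_iff] at hv ⊢
            rcases hv with rfl | rfl
            · exact Or.inl rfl
            · exact Or.inr rfl
        have := h _ hv'
        simp at this
        constructor
        · linarith [this.1]
        · have h3 := this.2; rw [abs_le] at h3 ⊢; constructor <;> linarith [h3.1, h3.2]
  · -- injectivity, reduced to the origin
    set τ₀ := shiftEdges (-Y) τ with hτ₀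
    set τ₀' := shiftEdges (-Y') τ' with hτ₀'
    have hP₀ : IsPolygon (zdGraph 2) τ₀ := isPolygon_shiftEdges hP _
    have hP₀' : IsPolygon (zdGraph 2) τ₀' := isPolygon_shiftEdges hP' _
    have hC₀ := capHyp_anchor hC
    have hC₀' := capHyp_anchor hC'
    rw [anchoredExt, anchoredExt] at hcol
    set d := Y' 0 - Y 0 with hd
    have hext : ext₀ τ₀ = ext₀ τ₀' + d := by rw [hd]; linarith
    have hYY : Y' = Y + xsh d := (site_ext_iff _ _).2 ⟨by simp [hd], by simp [hrow]⟩
    have hcap₀ : cap₀ τ₀ = shiftEdges (xsh d) (cap₀ τ₀') := by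
      rw [anchoredCap, anchoredCap] at hcap
      have := congrArg (shiftEdges (-Y)) hcap
      rw [shiftEdges_neg_shiftEdges, shiftEdges_shiftEdges] at this
      rw [this, show Y' + -Y = xsh d by rw [hYY]; abel]
    have key := h2 τ₀ τ₀' d hP₀ hC₀ hP₀' hC₀' hext hcap₀
    calc τ = shiftEdges Y τ₀ := (shiftEdges_shiftEdges_neg Y τ).symm
      _ = shiftEdges Y (shiftEdges (xsh d) τ₀') := by rw [key]
      _ = τ' := by
          rw [hτ₀', shiftEdges_shiftEdges, shiftEdges_shiftEdges, hYY,
            show -(Y + xsh d) + (xsh d + Y) = (0 : Site 2) by abel, shiftEdges_zero]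
  · -- equivariance
    refine ⟨?_, ?_⟩
    · rw [anchoredCap, anchoredCap, shiftEdges_shiftEdges, shiftEdges_shiftEdges]
      have : t + -(Y + t) = -Y := by abel
      rw [this, add_comm Y t, ← shiftEdges_shiftEdges]
    · rw [anchoredExt, anchoredExt, shiftEdges_shiftEdges]
      have : t + -(Y + t) = -Y := by abel
      rw [this]

/-! ### (2) A polygon has at most two edges at a vertex -/

/-- A polygon has at most two edges at any vertex. [folklore] -/
private theorem polygon_deg_le_two {V : Type*} [DecidableEq V] {G : SimpleGraph V} {E : Finset (Sym2 V)}
    (hE : IsPolygon G E) {v w₁ w₂ w₃ : V} (h₁ : s(v, w₁) ∈ E) (h₂ : s(v, w₂) ∈ E) (h₃ : s(v, w₃) ∈ E)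
    (h12 : w₁ ≠ w₂) (h13 : w₁ ≠ w₃) (h23 : w₂ ≠ w₃) : False := by
  classical
  obtain ⟨u, c, hc, rfl⟩ := hE
  have hv : v ∈ c.support := c.fst_mem_support_of_mem_edges (List.mem_toFinset.1 h₁)
  have hN : (c.toSubgraph.neighborSet v).ncard = 2 := hc.ncard_neighborSet_toSubgraph_eq_two hv
  have hmem : ∀ {w}, s(v, w) ∈ c.edges.toFinset → w ∈ c.toSubgraph.neighborSet v := fun {w} hw => by
    rw [Subgraph.mem_neighborSet, ← Subgraph.mem_edgeSet, Walk.mem_edges_toSubgraph]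
    exact List.mem_toFinset.1 hw
  have hsub : ({w₁, w₂, w₃} : Set V) ⊆ c.toSubgraph.neighborSet v := by
    intro w hw
    simp only [Set.mem_insert_iff, Set.mem_singleton_iff] at hw
    rcases hw with rfl | rfl | rfl
    · exact hmem h₁
    · exact hmem h₂
    · exact hmem h₃
  have hfin : (c.toSubgraph.neighborSet v).Finite := Set.finite_of_ncard_pos (by rw [hN]; norm_num)
  have h3 : ({w₁, w₂, w₃} : Set V).ncard = 3 := by
    rw [Set.ncard_insert_of_notMem (by simp [h12, h13]) (Set.toFinite _),
      Set.ncard_pair h23]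
  have := Set.ncard_le_ncard hsub hfin
  rw [h3, hN] at this
  omega

/-! ### (3) Single-strand rerouting of a polygon -/

section Reroute

variable {V : Type*} [DecidableEq V] {G : SimpleGraph V}

/-- **Rerouting one edge.** Replace the edge `uv` of a polygon `E` by a self-avoiding path `A : u ⟶ v` of length
`≥ 2` whose interior vertices avoid the vertices of `E`: the result is a polygon with `#E − 1 + |A|` edges. [folklore] -/
private theorem reroute_one {E : Finset (Sym2 V)} (hE : IsPolygon G E) {u v : V} (huv : s(u, v) ∈ E)
    {A : G.Walk u v} (hA : A.IsPath) (hlen : 2 ≤ A.length)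
    (hint : ∀ x ∈ A.support, x ≠ u → x ≠ v → ∀ e ∈ E, x ∉ e) :
    IsPolygon G (E.erase s(u, v) ∪ A.edges.toFinset) ∧
      (E.erase s(u, v) ∪ A.edges.toFinset).card + 1 = E.card + A.length := by
  have hvu : s(v, u) ∈ E := by rw [Sym2.eq_swap]; exact huv
  obtain ⟨P, hP, hPe, hPvu, hPl, hPs⟩ := hE.exists_isPath_erase hvu
  -- `A.append P : u → u` is a cycle
  have hcyc : (A.append P).IsCycle := by
    refine hA.isCycle_append hP ?_ (Or.inl (by omega))
    intro x hxA hxP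
    have hxv : x ≠ v := by
      rintro rfl
      have hnd := hP.support_nodup
      rw [← P.cons_tail_support, List.nodup_cons] at hnd
      exact hnd.1 hxP
    have hxu : x ≠ u := by
      rintro rfl
      have hnd := hA.support_nodup
      rw [← A.cons_tail_support, List.nodup_cons] at hnd
      exact hnd.1 hxA
    have hxE := (hPs x).1 (List.mem_of_mem_tail hxP)
    obtain ⟨e, he, hxe⟩ := hxE
    exact hint x (List.mem_of_mem_tail hxA) hxu hxv e he hxe
  have hedges : (A.append P).edges.toFinset = E.erase s(u, v) ∪ A.edges.toFinset := by
    rw [Walk.edges_append, List.toFinset_append, hPe, Sym2.eq_swap, Finset.union_comm]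
  refine ⟨⟨u, _, hcyc, hedges⟩, ?_⟩
  have hc := List.toFinset_card_of_nodup hcyc.edges_nodup
  rw [Walk.length_edges, Walk.length_append, hedges] at hc
  omega

/-- **Rerouting two consecutive edges.** Replace the sub-path `u – m – v` of a polygon `E` (`m` of degree two:
its only edges are `um`, `mv`) by a self-avoiding path `A : u ⟶ v` of length `≥ 1`, `u ≠ v`, whose interior
vertices avoid the vertices of `E`: the result is a polygon with `#E − 2 + |A|` edges. [folklore] -/
private theorem reroute_two {E : Finset (Sym2 V)} (hE : IsPolygon G E) {u m v : V} (hum : s(u, m) ∈ E)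
    (hmv : s(m, v) ∈ E) (huv : u ≠ v) (hm : ∀ w, s(m, w) ∈ E → w = u ∨ w = v)
    {A : G.Walk u v} (hA : A.IsPath) (hlen : 2 ≤ A.length)
    (hint : ∀ x ∈ A.support, x ≠ u → x ≠ v → ∀ e ∈ E, x ∉ e) :
    IsPolygon G ((E.erase s(u, m)).erase s(m, v) ∪ A.edges.toFinset) ∧
      ((E.erase s(u, m)).erase s(m, v) ∪ A.edges.toFinset).card + 2 = E.card + A.length := by
  have hvm : s(v, m) ∈ E := by rw [Sym2.eq_swap]; exact hmv
  have h3 : 3 ≤ E.card := by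
    obtain ⟨u', c, hc, hcE⟩ := hE
    rw [← hcE, List.toFinset_card_of_nodup hc.edges_nodup, Walk.length_edges]
    exact hc.three_le_length
  obtain ⟨P, hP, hPe, hPvm, hPl, hPs⟩ := hE.exists_isPath_erase hvm
  -- the last edge of `P : v ⟶ m` is `um`: look at the first edge of `P.reverse`
  have hPr := hP.reverse
  obtain ⟨w, hadj, Q, hQ⟩ : ∃ w, ∃ h : G.Adj m w, ∃ Q : G.Walk w v, P.reverse = Walk.cons h Q := by
    cases hp : P.reverse with
    | nil => exact absurd (congrArg Walk.length hp) (by rw [Walk.length_reverse, Walk.length_nil]; omega)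
    | cons h Q => exact ⟨_, h, Q, rfl⟩
  have hmw : s(m, w) ∈ E := by
    have : s(m, w) ∈ P.reverse.edges := by rw [hQ, Walk.edges_cons]; exact List.mem_cons_self
    rw [Walk.edges_reverse, List.mem_reverse, ← List.mem_toFinset, hPe] at this
    exact Finset.mem_of_mem_erase this
  have hwv : w ≠ v := by
    rintro rfl
    have : s(m, w) ∈ P.reverse.edges := by rw [hQ, Walk.edges_cons]; exact List.mem_cons_self
    rw [Walk.edges_reverse, List.mem_reverse] at this
    exact hPvm (by rw [Sym2.eq_swap]; exact this)
  have hwu : w = u := (hm w hmw).resolve_right hwv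
  subst hwu
  -- `Q : u ⟶ v` is a path with edges `E ∖ {um, mv}`
  have hQp : Q.IsPath := by
    have := hPr; rw [hQ, Walk.cons_isPath_iff] at this; exact this.1
  have hmQ : m ∉ Q.support := by
    have := hPr; rw [hQ, Walk.cons_isPath_iff] at this; exact this.2
  have hQe : Q.edges.toFinset = (E.erase s(w, m)).erase s(m, v) := by
    have h1 : P.reverse.edges.toFinset = E.erase s(v, m) := by
      rw [Walk.edges_reverse, List.toFinset_reverse, hPe]
    rw [hQ, Walk.edges_cons, List.toFinset_cons] at h1
    have hnot : s(m, w) ∉ Q.edges.toFinset := by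
      intro h
      exact hmQ (Q.fst_mem_support_of_mem_edges (List.mem_toFinset.1 h))
    calc Q.edges.toFinset = (insert s(m, w) Q.edges.toFinset).erase s(m, w) := (Finset.erase_insert hnot).symm
      _ = (E.erase s(v, m)).erase s(m, w) := by rw [h1]
      _ = (E.erase s(w, m)).erase s(m, v) := by
          rw [Finset.erase_right_comm, Sym2.eq_swap (a := m) (b := w), Sym2.eq_swap (a := v) (b := m)]
  have hQs : ∀ x ∈ Q.support, ∃ e ∈ E, x ∈ e := fun x hx => by
    have : x ∈ P.reverse.support := by rw [hQ, Walk.support_cons]; exact List.mem_cons_of_mem _ hx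
    rw [Walk.support_reverse, List.mem_reverse] at this
    exact (hPs x).1 this
  -- `A.append Q.reverse : u → u` is a cycle
  have hcyc : (A.append Q.reverse).IsCycle := by
    refine hA.isCycle_append hQp.reverse ?_ (Or.inl (by omega))
    · intro x hxA hxQ
      rw [Walk.support_reverse] at hxQ
      have hxQ' : x ∈ Q.support := by
        have := List.tail_subset _ hxQ
        rwa [List.mem_reverse] at this
      have hxv : x ≠ v := by
        rintro rfl
        -- `v` is the head of `Q.support.reverse`, not in its tail (nodup)
        have hnd : Q.support.reverse.Nodup := List.nodup_reverse.2 hQp.support_nodup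
        have hhead : Q.support.reverse = x :: Q.support.reverse.tail := by
          rw [← List.cons_head_tail (List.reverse_ne_nil_iff.2 Q.support_ne_nil)]
          congr 1
          rw [List.head_reverse, Q.getLast_support]
        rw [hhead, List.nodup_cons] at hnd
        exact hnd.1 hxQ
      have hxu : x ≠ w := by
        rintro rfl
        have hnd := hA.support_nodup
        rw [← A.cons_tail_support, List.nodup_cons] at hnd
        exact hnd.1 hxA
      obtain ⟨e, he, hxe⟩ := hQs x hxQ'
      exact hint x (List.mem_of_mem_tail hxA) hxu hxv e he hxe
  have hedges : (A.append Q.reverse).edges.toFinset = (E.erase s(w, m)).erase s(m, v) ∪ A.edges.toFinset := by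
    rw [Walk.edges_append, Walk.edges_reverse, List.toFinset_append, List.toFinset_reverse, hQe,
      Finset.union_comm]
  refine ⟨⟨w, _, hcyc, hedges⟩, ?_⟩
  have hQl : Q.length + 2 = E.card := by
    have := congrArg Walk.length hQ; rw [Walk.length_reverse, Walk.length_cons] at this; omega
  have hc := List.toFinset_card_of_nodup hcyc.edges_nodup
  rw [Walk.length_edges, Walk.length_append, Walk.length_reverse, hedges] at hc
  omega

end Reroute

/-! ### (4) The window at the origin: sites, neighbours, local degree facts -/

section Window

/-- `a = (0,1)`. -/  def sA : Site 2 := ![0, 1]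
/-- `b = (0,0)`. -/  def sB : Site 2 := ![0, 0]
/-- `c = (0,-1)`. -/ def sC : Site 2 := ![0, -1]
/-- `L₊ = (-1,1)`. -/ def sLp : Site 2 := ![-1, 1]
/-- `L₀ = (-1,0)`. -/ def sL0 : Site 2 := ![-1, 0]
/-- `L₋ = (-1,-1)`. -/ def sLm : Site 2 := ![-1, -1]
/-- `(0,2)` (top of `a_up`). -/ def sAup : Site 2 := ![0, 2]
/-- `(0,-2)` (bottom of `c_dn`). -/ def sCdn : Site 2 := ![0, -2]
/-- `(-2,0)` (left of `L₀`). -/ def sL0l : Site 2 := ![-2, 0]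

variable {τ : Finset (Sym2 (Site 2))}

/-- the four lattice neighbours of a concrete site. [cite: Hammond2015SAPJoining, §4.1 p. 18 (the empty right corridor; arXiv v5)] -/
private theorem nbr_cases {v w : Site 2} (h : (zdGraph 2).Adj v w) :
    w = ![v 0 + 1, v 1] ∨ w = ![v 0 - 1, v 1] ∨ w = ![v 0, v 1 + 1] ∨ w = ![v 0, v 1 - 1] := by
  rcases adj_cases h with rfl | rfl | rfl | rfl
  · left; funext i; fin_cases i <;> simp
  · right; left; funext i; fin_cases i <;> simp
  · right; right; left; funext i; fin_cases i <;> simp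
  · right; right; right; funext i; fin_cases i <;> simp

/-- polygon edges are lattice edges. [cite: Hammond2015SAPJoining, §4.1 p. 18 (the empty right corridor; arXiv v5)] -/
private theorem adj_of_mem (hτ : IsPolygon (zdGraph 2) τ) {v w : Site 2} (h : s(v, w) ∈ τ) : (zdGraph 2).Adj v w :=
  hτ.mem_edgeSet h

/-- no vertex of `τ` in the right corridor `{x ≥ 1} × {-1,0,1}` (from `CapHyp τ 0`). [cite: Hammond2015SAPJoining, §4.1 p. 18 (the empty right corridor; arXiv v5)] -/
theorem not_vert_of_corridor (hC : CapHyp τ 0) {v : Site 2} (h0 : 1 ≤ v 0) (h1 : |v 1| ≤ 1) :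
    v ∉ vertsOf τ := fun hv => by
  have := hC.2 v hv (by simp; omega)
  simp at this; omega

/-- an edge whose first endpoint is a right-corridor point is not in `τ`. [cite: Hammond2015SAPJoining, §4.1 p. 18 (the empty right corridor; arXiv v5)] -/
theorem not_mem_of_corridor_left (hC : CapHyp τ 0) {v w : Site 2} (h0 : 1 ≤ v 0) (h1 : |v 1| ≤ 1) :
    s(v, w) ∉ τ := fun h => not_vert_of_corridor hC h0 h1 (mem_vertsOf.2 ⟨_, h, Sym2.mem_mk_left _ _⟩)

/-- an edge whose second endpoint is a right-corridor point is not in `τ`. [cite: Hammond2015SAPJoining, §4.1 p. 18 (the empty right corridor; arXiv v5)] -/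
theorem not_mem_of_corridor_right (hC : CapHyp τ 0) {v w : Site 2} (h0 : 1 ≤ w 0) (h1 : |w 1| ≤ 1) :
    s(v, w) ∉ τ := fun h => not_vert_of_corridor hC h0 h1 (mem_vertsOf.2 ⟨_, h, Sym2.mem_mk_right _ _⟩)

/-- two distinct `τ`-neighbours at a vertex of the polygon `τ`. [cite: Hammond2015SAPJoining, §4.1 p. 18 (the empty right corridor; arXiv v5)] -/
private theorem two_nbrs (hτ : IsPolygon (zdGraph 2) τ) {v : Site 2} (hv : v ∈ vertsOf τ) :
    ∃ w₁ w₂ : Site 2, w₁ ≠ w₂ ∧ s(v, w₁) ∈ τ ∧ s(v, w₂) ∈ τ ∧ (zdGraph 2).Adj v w₁ ∧ (zdGraph 2).Adj v w₂ :=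
  hτ.exists_two_edges (mem_vertsOf.1 hv)

/-- `b ∉ τ` once `ab, bc ∉ τ` (the rightward edge at `b` is excluded by the empty corridor). [cite: Hammond2015SAPJoining, §4.1 p. 18 (the empty right corridor; arXiv v5)] -/
private theorem sB_not_vert (hτ : IsPolygon (zdGraph 2) τ) (hC : CapHyp τ 0) (hab : s(sB, sA) ∉ τ) (hbc : s(sB, sC) ∉ τ) :
    sB ∉ vertsOf τ := by
  intro hv
  obtain ⟨w₁, w₂, hne, h₁, h₂, a₁, a₂⟩ := two_nbrs hτ hv
  have key : ∀ w, s(sB, w) ∈ τ → (zdGraph 2).Adj sB w → w = ![-1, 0] := by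
    intro w hw ha
    rcases nbr_cases ha with rfl | rfl | rfl | rfl
    · exact absurd hw (not_mem_of_corridor_right hC (by simp [sB]) (by simp [sB]))
    · simp [sB]
    · exfalso; apply hab; convert hw using 2; simp [sA, sB]
    · exfalso; apply hbc; convert hw using 2; simp [sC, sB]
  exact hne ((key w₁ h₁ a₁).trans (key w₂ h₂ a₂).symm)

/-- `a ∈ τ` with `ab ∉ τ` forces the edges `a_up` and `aL₊`. [cite: Hammond2015SAPJoining, §4.1 p. 18 (the empty right corridor; arXiv v5)] -/
private theorem sA_edges (hτ : IsPolygon (zdGraph 2) τ) (hC : CapHyp τ 0) (ha : sA ∈ vertsOf τ) (hab : s(sB, sA) ∉ τ) :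
    s(sA, sAup) ∈ τ ∧ s(sLp, sA) ∈ τ := by
  obtain ⟨w₁, w₂, hne, h₁, h₂, a₁, a₂⟩ := two_nbrs hτ ha
  have key : ∀ w, s(sA, w) ∈ τ → (zdGraph 2).Adj sA w → w = sAup ∨ w = sLp := by
    intro w hw ha'
    rcases nbr_cases ha' with rfl | rfl | rfl | rfl
    · exact absurd hw (not_mem_of_corridor_right hC (by simp [sA]) (by simp [sA]))
    · right; simp [sA, sLp]
    · left; simp [sA, sAup]
    · exfalso; apply hab; rw [Sym2.eq_swap]; convert hw using 2; simp [sA, sB]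
  rcases key w₁ h₁ a₁ with rfl | rfl <;> rcases key w₂ h₂ a₂ with rfl | rfl
  · exact absurd rfl hne
  · exact ⟨h₁, by rw [Sym2.eq_swap]; exact h₂⟩
  · exact ⟨h₂, by rw [Sym2.eq_swap]; exact h₁⟩
  · exact absurd rfl hne

/-- `a ∉ τ` once `ab, aL₊ ∉ τ`. [cite: Hammond2015SAPJoining, §4.1 p. 18 (the empty right corridor; arXiv v5)] -/
private theorem sA_not_vert (hτ : IsPolygon (zdGraph 2) τ) (hC : CapHyp τ 0) (hab : s(sB, sA) ∉ τ) (haL : s(sLp, sA) ∉ τ) :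
    sA ∉ vertsOf τ := fun ha => haL (sA_edges hτ hC ha hab).2

/-- `c ∈ τ` with `bc ∉ τ` forces the edges `c_dn` and `cL₋`. [cite: Hammond2015SAPJoining, §4.1 p. 18 (the empty right corridor; arXiv v5)] -/
private theorem sC_edges (hτ : IsPolygon (zdGraph 2) τ) (hC : CapHyp τ 0) (hc : sC ∈ vertsOf τ) (hbc : s(sB, sC) ∉ τ) :
    s(sC, sCdn) ∈ τ ∧ s(sLm, sC) ∈ τ := by
  obtain ⟨w₁, w₂, hne, h₁, h₂, a₁, a₂⟩ := two_nbrs hτ hc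
  have key : ∀ w, s(sC, w) ∈ τ → (zdGraph 2).Adj sC w → w = sCdn ∨ w = sLm := by
    intro w hw ha'
    rcases nbr_cases ha' with rfl | rfl | rfl | rfl
    · exact absurd hw (not_mem_of_corridor_right hC (by simp [sC]) (by simp [sC]))
    · right; simp [sC, sLm]
    · exfalso; apply hbc; rw [Sym2.eq_swap]; convert hw using 2; simp [sC, sB]
    · left; simp [sC, sCdn]
  rcases key w₁ h₁ a₁ with rfl | rfl <;> rcases key w₂ h₂ a₂ with rfl | rfl
  · exact absurd rfl hne
  · exact ⟨h₁, by rw [Sym2.eq_swap]; exact h₂⟩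
  · exact ⟨h₂, by rw [Sym2.eq_swap]; exact h₁⟩
  · exact absurd rfl hne

/-- `c ∉ τ` once `bc, cL₋ ∉ τ`. [cite: Hammond2015SAPJoining, §4.1 p. 18 (the empty right corridor; arXiv v5)] -/
private theorem sC_not_vert (hτ : IsPolygon (zdGraph 2) τ) (hC : CapHyp τ 0) (hbc : s(sB, sC) ∉ τ) (hcL : s(sLm, sC) ∉ τ) :
    sC ∉ vertsOf τ := fun hc => hcL (sC_edges hτ hC hc hbc).2

/-- `L₀ ∉ τ` once at most one lattice neighbour of `L₀` can carry a `τ`-edge. [cite: Hammond2015SAPJoining, §4.1 p. 18 (the empty right corridor; arXiv v5)] -/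
private theorem sL0_not_vert (hτ : IsPolygon (zdGraph 2) τ) {p : Site 2} (hone : ∀ w, s(sL0, w) ∈ τ → w = p) :
    sL0 ∉ vertsOf τ := by
  intro hv
  obtain ⟨w₁, w₂, hne, h₁, h₂, -, -⟩ := two_nbrs hτ hv
  exact hne ((hone w₁ h₁).trans (hone w₂ h₂).symm)

/-- the four neighbours of `L₀`. [cite: Hammond2015SAPJoining, §4.1 p. 18 (the empty right corridor; arXiv v5)] -/
private theorem nbrs_sL0 {w : Site 2} (h : (zdGraph 2).Adj sL0 w) : w = sB ∨ w = sLp ∨ w = sLm ∨ w = sL0l := by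
  rcases nbr_cases h with rfl | rfl | rfl | rfl
  · left; simp [sL0, sB]
  · right; right; right; simp [sL0, sL0l]
  · right; left; simp [sL0, sLp]
  · right; right; left; simp [sL0, sLm]

/-- degree `≤ 2` at `L₊`: with edges to `L₀` and `a` present, no other edge at `L₊`. [cite: Hammond2015SAPJoining, §4.1 p. 18 (the empty right corridor; arXiv v5)] -/
private theorem sLp_only (hτ : IsPolygon (zdGraph 2) τ) (h1 : s(sL0, sLp) ∈ τ) (h2 : s(sLp, sA) ∈ τ) :
    ∀ w, s(sLp, w) ∈ τ → w = sL0 ∨ w = sA := by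
  intro w hw
  have ha := adj_of_mem hτ hw
  by_contra hnot
  push Not at hnot
  have h1' : s(sLp, sL0) ∈ τ := by rw [Sym2.eq_swap]; exact h1
  exact polygon_deg_le_two hτ h1' h2 hw (by decide) (Ne.symm hnot.1) (Ne.symm hnot.2)

/-- degree `≤ 2` at `L₋`: with edges to `L₀` and `c` present, no other edge at `L₋`. [cite: Hammond2015SAPJoining, §4.1 p. 18 (the empty right corridor; arXiv v5)] -/
private theorem sLm_only (hτ : IsPolygon (zdGraph 2) τ) (h1 : s(sL0, sLm) ∈ τ) (h2 : s(sLm, sC) ∈ τ) :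
    ∀ w, s(sLm, w) ∈ τ → w = sL0 ∨ w = sC := by
  intro w hw
  by_contra hnot
  push Not at hnot
  have h1' : s(sLm, sL0) ∈ τ := by rw [Sym2.eq_swap]; exact h1
  exact polygon_deg_le_two hτ h1' h2 hw (by decide) (Ne.symm hnot.1) (Ne.symm hnot.2)

/-- some `τ`-vertex among `a, b, c` (from `CapHyp τ 0`). [cite: Hammond2015SAPJoining, §4.1 p. 18 (the empty right corridor; arXiv v5)] -/
private theorem vert_abc (hC : CapHyp τ 0) : sA ∈ vertsOf τ ∨ sB ∈ vertsOf τ ∨ sC ∈ vertsOf τ := by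
  obtain ⟨⟨t, ht, h0, h1⟩, -⟩ := hC
  simp at h0 h1
  rw [abs_le] at h1
  have : t = sA ∨ t = sB ∨ t = sC := by
    rcases (show t 1 = 1 ∨ t 1 = 0 ∨ t 1 = -1 by omega) with h | h | h
    · left; exact (site_ext_iff _ _).2 ⟨by simp [sA, h0], by simp [sA, h]⟩
    · right; left; exact (site_ext_iff _ _).2 ⟨by simp [sB, h0], by simp [sB, h]⟩
    · right; right; exact (site_ext_iff _ _).2 ⟨by simp [sC, h0], by simp [sC, h]⟩
  rcases this with rfl | rfl | rfl
  · exact Or.inl ht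
  · exact Or.inr (Or.inl ht)
  · exact Or.inr (Or.inr ht)

end Window

/-! ### (5) The rule at the origin: branches, detours, `cap₀`, `ext₀` -/

section Rule

/-- the detour `C9std(+1)` from `b` to `a` (branch `A_up`). [cite: Hammond2015SAPJoining, §4.1 p. 18 (Madras' local modification: one or two edges removed, nine or ten added; arXiv v5)] -/
def wAup : (zdGraph 2).Walk sB sA :=
  Walk.cons (v := ![1,0]) (by decide) <| Walk.cons (v := ![1,-1]) (by decide) <| Walk.cons (v := ![2,-1]) (by decide) <|
  Walk.cons (v := ![3,-1]) (by decide) <| Walk.cons (v := ![3,0]) (by decide) <| Walk.cons (v := ![3,1]) (by decide) <|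
  Walk.cons (v := ![2,1]) (by decide) <| Walk.cons (v := ![1,1]) (by decide) <| Walk.cons (v := sA) (by decide) Walk.nil
/-- the detour `C9std(−1)` from `b` to `c` (branch `A_dn`). [cite: Hammond2015SAPJoining, §4.1 p. 18 (Madras' local modification: one or two edges removed, nine or ten added; arXiv v5)] -/
def wAdn : (zdGraph 2).Walk sB sC :=
  Walk.cons (v := ![1,0]) (by decide) <| Walk.cons (v := ![1,1]) (by decide) <| Walk.cons (v := ![2,1]) (by decide) <|
  Walk.cons (v := ![3,1]) (by decide) <| Walk.cons (v := ![3,0]) (by decide) <| Walk.cons (v := ![3,-1]) (by decide) <|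
  Walk.cons (v := ![2,-1]) (by decide) <| Walk.cons (v := ![1,-1]) (by decide) <| Walk.cons (v := sC) (by decide) Walk.nil
/-- `L₀ → b → C9alt(+1) → a` (branch `G2u`). [cite: Hammond2015SAPJoining, §4.1 p. 18 (Madras' local modification: one or two edges removed, nine or ten added; arXiv v5)] -/
def wG2u : (zdGraph 2).Walk sL0 sA :=
  Walk.cons (v := sB) (by decide) <| Walk.cons (v := ![1,0]) (by decide) <| Walk.cons (v := ![2,0]) (by decide) <|
  Walk.cons (v := ![2,-1]) (by decide) <| Walk.cons (v := ![3,-1]) (by decide) <| Walk.cons (v := ![3,0]) (by decide) <|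
  Walk.cons (v := ![3,1]) (by decide) <| Walk.cons (v := ![2,1]) (by decide) <| Walk.cons (v := ![1,1]) (by decide) <|
  Walk.cons (v := sA) (by decide) Walk.nil
/-- `L₀ → b → C9alt(−1) → c` (branches `G3pu`, `G2d`). [cite: Hammond2015SAPJoining, §4.1 p. 18 (Madras' local modification: one or two edges removed, nine or ten added; arXiv v5)] -/
def wGm : (zdGraph 2).Walk sL0 sC :=
  Walk.cons (v := sB) (by decide) <| Walk.cons (v := ![1,0]) (by decide) <| Walk.cons (v := ![2,0]) (by decide) <|
  Walk.cons (v := ![2,1]) (by decide) <| Walk.cons (v := ![3,1]) (by decide) <| Walk.cons (v := ![3,0]) (by decide) <|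
  Walk.cons (v := ![3,-1]) (by decide) <| Walk.cons (v := ![2,-1]) (by decide) <| Walk.cons (v := ![1,-1]) (by decide) <|
  Walk.cons (v := sC) (by decide) Walk.nil
/-- `L₀ → b → C7(−1) → c → L₋` (branch `G3u`). [cite: Hammond2015SAPJoining, §4.1 p. 18 (Madras' local modification: one or two edges removed, nine or ten added; arXiv v5)] -/
def wG3u : (zdGraph 2).Walk sL0 sLm :=
  Walk.cons (v := sB) (by decide) <| Walk.cons (v := ![1,0]) (by decide) <| Walk.cons (v := ![1,1]) (by decide) <|
  Walk.cons (v := ![2,1]) (by decide) <| Walk.cons (v := ![2,0]) (by decide) <| Walk.cons (v := ![2,-1]) (by decide) <|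
  Walk.cons (v := ![1,-1]) (by decide) <| Walk.cons (v := sC) (by decide) <| Walk.cons (v := sLm) (by decide) Walk.nil
/-- `L₊ → L₀ → b → C7(+1) → a` (branch `G1u`). [cite: Hammond2015SAPJoining, §4.1 p. 18 (Madras' local modification: one or two edges removed, nine or ten added; arXiv v5)] -/
def wG1u : (zdGraph 2).Walk sLp sA :=
  Walk.cons (v := sL0) (by decide) <| Walk.cons (v := sB) (by decide) <| Walk.cons (v := ![1,0]) (by decide) <|
  Walk.cons (v := ![1,-1]) (by decide) <| Walk.cons (v := ![2,-1]) (by decide) <| Walk.cons (v := ![2,0]) (by decide) <|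
  Walk.cons (v := ![2,1]) (by decide) <| Walk.cons (v := ![1,1]) (by decide) <| Walk.cons (v := sA) (by decide) Walk.nil
/-- `L₀ → b → C7(+1) → a → L₊` (branch `G3d`). [cite: Hammond2015SAPJoining, §4.1 p. 18 (Madras' local modification: one or two edges removed, nine or ten added; arXiv v5)] -/
def wG3d : (zdGraph 2).Walk sL0 sLp :=
  Walk.cons (v := sB) (by decide) <| Walk.cons (v := ![1,0]) (by decide) <| Walk.cons (v := ![1,-1]) (by decide) <|
  Walk.cons (v := ![2,-1]) (by decide) <| Walk.cons (v := ![2,0]) (by decide) <| Walk.cons (v := ![2,1]) (by decide) <|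
  Walk.cons (v := ![1,1]) (by decide) <| Walk.cons (v := sA) (by decide) <| Walk.cons (v := sLp) (by decide) Walk.nil
/-- `L₋ → L₀ → b → C7(−1) → c` (branch `G1d`). [cite: Hammond2015SAPJoining, §4.1 p. 18 (Madras' local modification: one or two edges removed, nine or ten added; arXiv v5)] -/
def wG1d : (zdGraph 2).Walk sLm sC :=
  Walk.cons (v := sL0) (by decide) <| Walk.cons (v := sB) (by decide) <| Walk.cons (v := ![1,0]) (by decide) <|
  Walk.cons (v := ![1,1]) (by decide) <| Walk.cons (v := ![2,1]) (by decide) <| Walk.cons (v := ![2,0]) (by decide) <|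
  Walk.cons (v := ![2,-1]) (by decide) <| Walk.cons (v := ![1,-1]) (by decide) <| Walk.cons (v := sC) (by decide) Walk.nil

/-- `wAup_isPath`. [cite: Hammond2015SAPJoining, §4.1 p. 18 (Madras' local modification: one or two edges removed, nine or ten added; arXiv v5)] -/
private theorem wAup_isPath : wAup.IsPath := by rw [Walk.isPath_def]; decide
/-- `wAdn_isPath`. [cite: Hammond2015SAPJoining, §4.1 p. 18 (Madras' local modification: one or two edges removed, nine or ten added; arXiv v5)] -/
private theorem wAdn_isPath : wAdn.IsPath := by rw [Walk.isPath_def]; decide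
/-- `wG2u_isPath`. [cite: Hammond2015SAPJoining, §4.1 p. 18 (Madras' local modification: one or two edges removed, nine or ten added; arXiv v5)] -/
private theorem wG2u_isPath : wG2u.IsPath := by rw [Walk.isPath_def]; decide
/-- `wGm_isPath`. [cite: Hammond2015SAPJoining, §4.1 p. 18 (Madras' local modification: one or two edges removed, nine or ten added; arXiv v5)] -/
private theorem wGm_isPath : wGm.IsPath := by rw [Walk.isPath_def]; decide
/-- `wG3u_isPath`. [cite: Hammond2015SAPJoining, §4.1 p. 18 (Madras' local modification: one or two edges removed, nine or ten added; arXiv v5)] -/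
private theorem wG3u_isPath : wG3u.IsPath := by rw [Walk.isPath_def]; decide
/-- `wG1u_isPath`. [cite: Hammond2015SAPJoining, §4.1 p. 18 (Madras' local modification: one or two edges removed, nine or ten added; arXiv v5)] -/
private theorem wG1u_isPath : wG1u.IsPath := by rw [Walk.isPath_def]; decide
/-- `wG3d_isPath`. [cite: Hammond2015SAPJoining, §4.1 p. 18 (Madras' local modification: one or two edges removed, nine or ten added; arXiv v5)] -/
private theorem wG3d_isPath : wG3d.IsPath := by rw [Walk.isPath_def]; decide
/-- `wG1d_isPath`. [cite: Hammond2015SAPJoining, §4.1 p. 18 (Madras' local modification: one or two edges removed, nine or ten added; arXiv v5)] -/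
private theorem wG1d_isPath : wG1d.IsPath := by rw [Walk.isPath_def]; decide

/-- the nine branches of the rule. [cite: Hammond2015SAPJoining, §4.1 p. 18 (Madras' local modification: one or two edges removed, nine or ten added; arXiv v5)] -/
inductive Br | Aup | Adn | G1u | G2u | G3u | G3pu | G1d | G2d | G3d
  deriving DecidableEq, Fintype

/-- extension (`2` for `C7` caps, `3` for `C9` caps). [cite: Hammond2015SAPJoining, §4.1 p. 18 (Madras' local modification: one or two edges removed, nine or ten added; arXiv v5)] -/
def Br.ext : Br → ℤ
  | .Aup => 3 | .Adn => 3 | .G2u => 3 | .G3pu => 3 | .G2d => 3 | .G1u => 2 | .G3u => 2 | .G1d => 2 | .G3d => 2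

/-- the added detour edges. [cite: Hammond2015SAPJoining, §4.1 p. 18 (Madras' local modification: one or two edges removed, nine or ten added; arXiv v5)] -/
def Br.A : Br → Finset (Sym2 (Site 2))
  | .Aup => wAup.edges.toFinset | .Adn => wAdn.edges.toFinset | .G1u => wG1u.edges.toFinset | .G2u => wG2u.edges.toFinset
  | .G3u => wG3u.edges.toFinset | .G3pu => wGm.edges.toFinset | .G1d => wG1d.edges.toFinset | .G2d => wGm.edges.toFinset
  | .G3d => wG3d.edges.toFinset

/-- removing the branch's sub-path `R` from `τ`. [cite: Hammond2015SAPJoining, §4.1 p. 18 (Madras' local modification: one or two edges removed, nine or ten added; arXiv v5)] -/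
def Br.rem : Br → Finset (Sym2 (Site 2)) → Finset (Sym2 (Site 2))
  | .Aup, τ => τ.erase s(sB, sA)
  | .Adn, τ => τ.erase s(sB, sC)
  | .G1u, τ => τ.erase s(sLp, sA)
  | .G2u, τ => (τ.erase s(sL0, sLp)).erase s(sLp, sA)
  | .G3u, τ => τ.erase s(sL0, sLm)
  | .G3pu, τ => (τ.erase s(sL0, sLm)).erase s(sLm, sC)
  | .G1d, τ => τ.erase s(sLm, sC)
  | .G2d, τ => (τ.erase s(sL0, sLm)).erase s(sLm, sC)
  | .G3d, τ => τ.erase s(sL0, sLp)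

/-- the removed edges as a set. [cite: Hammond2015SAPJoining, §4.1 p. 18 (Madras' local modification: one or two edges removed, nine or ten added; arXiv v5)] -/
def Br.R : Br → Finset (Sym2 (Site 2))
  | .Aup => {s(sB, sA)} | .Adn => {s(sB, sC)} | .G1u => {s(sLp, sA)} | .G2u => {s(sL0, sLp), s(sLp, sA)}
  | .G3u => {s(sL0, sLm)} | .G3pu => {s(sL0, sLm), s(sLm, sC)} | .G1d => {s(sLm, sC)}
  | .G2d => {s(sL0, sLm), s(sLm, sC)} | .G3d => {s(sL0, sLp)}

/-- `Br.mem_rem`. [cite: Hammond2015SAPJoining, §4.1 p. 18 (Madras' local modification: one or two edges removed, nine or ten added; arXiv v5)] -/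
private theorem Br.mem_rem {β : Br} {τ : Finset (Sym2 (Site 2))} {e : Sym2 (Site 2)} :
    e ∈ β.rem τ ↔ e ∈ τ ∧ e ∉ β.R := by
  cases β <;> simp [Br.rem, Br.R] <;> tauto

open Classical in
/-- **the branch of `τ`** (first match wins; conditions read off `τ`'s edges at the six window sites). [cite: Hammond2015SAPJoining, §4.1 p. 18 (Madras' local modification: one or two edges removed, nine or ten added; arXiv v5)] -/
def br (τ : Finset (Sym2 (Site 2))) : Br :=
  if s(sB, sA) ∈ τ then .Aup
  else if s(sB, sC) ∈ τ then .Adn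
  else if s(sLp, sA) ∈ τ then
    (if s(sL0, sLp) ∈ τ then .G2u
     else if s(sL0l, sL0) ∈ τ then (if s(sLm, sC) ∈ τ then .G3pu else .G3u)
     else .G1u)
  else
    (if s(sL0, sLm) ∈ τ then .G2d
     else if s(sL0l, sL0) ∈ τ then .G3d
     else .G1d)

/-- **the cap rule at the origin**: `τ ↦ (τ ∖ R) ∪ A`. [cite: Hammond2015SAPJoining, §4.1 p. 18 (Madras' local modification: one or two edges removed, nine or ten added; arXiv v5)] -/
def cap₀ (τ : Finset (Sym2 (Site 2))) : Finset (Sym2 (Site 2)) := (br τ).rem τ ∪ (br τ).A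

/-- the extension at the origin. [cite: Hammond2015SAPJoining, §4.1 p. 18 (Madras' local modification: one or two edges removed, nine or ten added; arXiv v5)] -/
def ext₀ (τ : Finset (Sym2 (Site 2))) : ℤ := (br τ).ext

/-- what the branch of `τ` guarantees about `τ` near the window. [cite: Hammond2015SAPJoining, §4.1 p. 18 (Madras' local modification: one or two edges removed, nine or ten added; arXiv v5)] -/
def BrFacts (τ : Finset (Sym2 (Site 2))) : Br → Prop
  | .Aup => s(sB, sA) ∈ τ
  | .Adn => s(sB, sC) ∈ τ
  | .G1u => s(sLp, sA) ∈ τ ∧ s(sA, sAup) ∈ τ ∧ sB ∉ vertsOf τ ∧ sL0 ∉ vertsOf τ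
  | .G2u => s(sL0, sLp) ∈ τ ∧ s(sLp, sA) ∈ τ ∧ sB ∉ vertsOf τ ∧ (∀ w, s(sLp, w) ∈ τ → w = sL0 ∨ w = sA)
  | .G3u => s(sL0, sLm) ∈ τ ∧ s(sA, sAup) ∈ τ ∧ sB ∉ vertsOf τ ∧ sC ∉ vertsOf τ
  | .G3pu => s(sL0, sLm) ∈ τ ∧ s(sLm, sC) ∈ τ ∧ sB ∉ vertsOf τ ∧ (∀ w, s(sLm, w) ∈ τ → w = sL0 ∨ w = sC)
  | .G1d => s(sLm, sC) ∈ τ ∧ s(sC, sCdn) ∈ τ ∧ sB ∉ vertsOf τ ∧ sL0 ∉ vertsOf τ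
  | .G2d => s(sL0, sLm) ∈ τ ∧ s(sLm, sC) ∈ τ ∧ sB ∉ vertsOf τ ∧ (∀ w, s(sLm, w) ∈ τ → w = sL0 ∨ w = sC)
  | .G3d => s(sL0, sLp) ∈ τ ∧ s(sC, sCdn) ∈ τ ∧ sB ∉ vertsOf τ ∧ sA ∉ vertsOf τ

variable {τ : Finset (Sym2 (Site 2))}

/-- both remaining edges at `L₀ ∈ τ` when `b ∉ τ` and one more neighbour is excluded. [cite: Hammond2015SAPJoining, §4.1 p. 18 (Madras' local modification: one or two edges removed, nine or ten added; arXiv v5)] -/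
private theorem sL0_two (hτ : IsPolygon (zdGraph 2) τ) (hv : sL0 ∈ vertsOf τ) (hb : sB ∉ vertsOf τ)
    {p q r : Site 2} (hperm : ∀ w, (zdGraph 2).Adj sL0 w → w = sB ∨ w = p ∨ w = q ∨ w = r)
    (hq : s(sL0, q) ∉ τ) (hpr : p ≠ r) : s(sL0, p) ∈ τ ∧ s(sL0, r) ∈ τ := by
  obtain ⟨w₁, w₂, hne, h₁, h₂, a₁, a₂⟩ := two_nbrs hτ hv
  have key : ∀ w, s(sL0, w) ∈ τ → (zdGraph 2).Adj sL0 w → w = p ∨ w = r := by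
    intro w hw ha
    rcases hperm w ha with rfl | rfl | rfl | rfl
    · exact absurd (mem_vertsOf.2 ⟨_, hw, Sym2.mem_mk_right _ _⟩) hb
    · exact Or.inl rfl
    · exact absurd hw hq
    · exact Or.inr rfl
  rcases key w₁ h₁ a₁ with rfl | rfl <;> rcases key w₂ h₂ a₂ with rfl | rfl
  · exact absurd rfl hne
  · exact ⟨h₁, h₂⟩
  · exact ⟨h₂, h₁⟩
  · exact absurd rfl hne

/-- `nbrs_sL0_perm1`. [cite: Hammond2015SAPJoining, §4.1 p. 18 (Madras' local modification: one or two edges removed, nine or ten added; arXiv v5)] -/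
private theorem nbrs_sL0_perm1 {w : Site 2} (h : (zdGraph 2).Adj sL0 w) : w = sB ∨ w = sLm ∨ w = sLp ∨ w = sL0l := by
  rcases nbrs_sL0 h with h | h | h | h <;> simp [h]
/-- `nbrs_sL0_perm2`. [cite: Hammond2015SAPJoining, §4.1 p. 18 (Madras' local modification: one or two edges removed, nine or ten added; arXiv v5)] -/
private theorem nbrs_sL0_perm2 {w : Site 2} (h : (zdGraph 2).Adj sL0 w) : w = sB ∨ w = sLp ∨ w = sLm ∨ w = sL0l := by
  rcases nbrs_sL0 h with h | h | h | h <;> simp [h]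

/-- `sL0l_swap`. [cite: Hammond2015SAPJoining, §4.1 p. 18 (Madras' local modification: one or two edges removed, nine or ten added; arXiv v5)] -/
private theorem sL0l_swap : s(sL0, sL0l) = s(sL0l, sL0) := Sym2.eq_swap

/-- **the branch facts hold** for a polygon with an empty right corridor and a vertex in the column triple. [cite: Hammond2015SAPJoining, §4.1 p. 18 (Madras' local modification: one or two edges removed, nine or ten added; arXiv v5)] -/
theorem br_spec (hτ : IsPolygon (zdGraph 2) τ) (hC : CapHyp τ 0) : BrFacts τ (br τ) := by
  unfold br
  split_ifs with hab hbc haL hL0Lp hL0l hcL hL0Lm hL0l'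
  · exact hab
  · exact hbc
  · -- G2u
    exact ⟨hL0Lp, haL, sB_not_vert hτ hC hab hbc, sLp_only hτ hL0Lp haL⟩
  · -- G3pu
    have hb := sB_not_vert hτ hC hab hbc
    have hv : sL0 ∈ vertsOf τ := mem_vertsOf.2 ⟨_, hL0l, Sym2.mem_mk_right _ _⟩
    have hLm : s(sL0, sLm) ∈ τ := (sL0_two hτ hv hb (p := sLm) (q := sLp) (r := sL0l) (fun w hw => nbrs_sL0_perm1 hw) hL0Lp (by decide)).1
    exact ⟨hLm, hcL, hb, sLm_only hτ hLm hcL⟩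
  · -- G3u
    have hb := sB_not_vert hτ hC hab hbc
    have hv : sL0 ∈ vertsOf τ := mem_vertsOf.2 ⟨_, hL0l, Sym2.mem_mk_right _ _⟩
    have hLm : s(sL0, sLm) ∈ τ := (sL0_two hτ hv hb (p := sLm) (q := sLp) (r := sL0l) (fun w hw => nbrs_sL0_perm1 hw) hL0Lp (by decide)).1
    have ha : sA ∈ vertsOf τ := mem_vertsOf.2 ⟨_, haL, Sym2.mem_mk_right _ _⟩
    exact ⟨hLm, (sA_edges hτ hC ha hab).1, hb, sC_not_vert hτ hC hbc hcL⟩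
  · -- G1u
    have hb := sB_not_vert hτ hC hab hbc
    have ha : sA ∈ vertsOf τ := mem_vertsOf.2 ⟨_, haL, Sym2.mem_mk_right _ _⟩
    refine ⟨haL, (sA_edges hτ hC ha hab).1, hb, sL0_not_vert hτ (p := sLm) fun w hw => ?_⟩
    rcases nbrs_sL0 (adj_of_mem hτ hw) with rfl | rfl | rfl | rfl
    · exact absurd (mem_vertsOf.2 ⟨_, hw, Sym2.mem_mk_right _ _⟩) hb
    · exact absurd hw hL0Lp
    · rfl
    · rw [sL0l_swap] at hw; exact absurd hw hL0l
  · -- G2d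
    have hb := sB_not_vert hτ hC hab hbc
    have hc : sC ∈ vertsOf τ := by
      rcases vert_abc hC with h | h | h
      · exact absurd h (sA_not_vert hτ hC hab haL)
      · exact absurd h hb
      · exact h
    have hcL := (sC_edges hτ hC hc hbc).2
    exact ⟨hL0Lm, hcL, hb, sLm_only hτ hL0Lm hcL⟩
  · -- G3d
    have hb := sB_not_vert hτ hC hab hbc
    have hc : sC ∈ vertsOf τ := by
      rcases vert_abc hC with h | h | h
      · exact absurd h (sA_not_vert hτ hC hab haL)
      · exact absurd h hb
      · exact h
    have hv : sL0 ∈ vertsOf τ := mem_vertsOf.2 ⟨_, hL0l', Sym2.mem_mk_right _ _⟩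
    have hLp : s(sL0, sLp) ∈ τ := (sL0_two hτ hv hb (p := sLp) (q := sLm) (r := sL0l) (fun w hw => nbrs_sL0_perm2 hw) hL0Lm (by decide)).1
    exact ⟨hLp, (sC_edges hτ hC hc hbc).1, hb, sA_not_vert hτ hC hab haL⟩
  · -- G1d
    have hb := sB_not_vert hτ hC hab hbc
    have hc : sC ∈ vertsOf τ := by
      rcases vert_abc hC with h | h | h
      · exact absurd h (sA_not_vert hτ hC hab haL)
      · exact absurd h hb
      · exact h
    refine ⟨(sC_edges hτ hC hc hbc).2, (sC_edges hτ hC hc hbc).1, hb, sL0_not_vert hτ (p := sLp) fun w hw => ?_⟩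
    rcases nbrs_sL0 (adj_of_mem hτ hw) with rfl | rfl | rfl | rfl
    · exact absurd (mem_vertsOf.2 ⟨_, hw, Sym2.mem_mk_right _ _⟩) hb
    · rfl
    · exact absurd hw hL0Lm
    · rw [sL0l_swap] at hw; exact absurd hw hL0l'

end Rule

/-! ### (6) The clauses of `AnchoredSpec` for `cap₀` -/

section Clauses

variable {τ : Finset (Sym2 (Site 2))}

/-- `mem_support_of_mem_vertsOf`. [cite: Hammond2015SAPJoining, §4.1 p. 18 (Madras' local modification: one or two edges removed, nine or ten added; arXiv v5)] -/
private theorem mem_support_of_mem_vertsOf {u v : Site 2} (p : (zdGraph 2).Walk u v) {x : Site 2}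
    (hx : x ∈ vertsOf p.edges.toFinset) : x ∈ p.support := by
  obtain ⟨e, he, hxe⟩ := mem_vertsOf.1 hx
  rw [List.mem_toFinset] at he
  induction e using Sym2.ind with
  | _ a b =>
    rcases Sym2.mem_iff.1 hxe with rfl | rfl
    · exact p.fst_mem_support_of_mem_edges he
    · exact p.snd_mem_support_of_mem_edges he

/-- interior points of the detours: corridor points or the free window sites of the branch. [cite: Hammond2015SAPJoining, §4.1 p. 18 (Madras' local modification: one or two edges removed, nine or ten added; arXiv v5)] -/
private theorem int_wAup : ∀ x ∈ wAup.support, x ≠ sB → x ≠ sA → (1 ≤ x 0 ∧ |x 1| ≤ 1) := by decide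
/-- `int_wAdn`. [cite: Hammond2015SAPJoining, §4.1 p. 18 (Madras' local modification: one or two edges removed, nine or ten added; arXiv v5)] -/
private theorem int_wAdn : ∀ x ∈ wAdn.support, x ≠ sB → x ≠ sC → (1 ≤ x 0 ∧ |x 1| ≤ 1) := by decide
/-- `int_wG2u`. [cite: Hammond2015SAPJoining, §4.1 p. 18 (Madras' local modification: one or two edges removed, nine or ten added; arXiv v5)] -/
private theorem int_wG2u : ∀ x ∈ wG2u.support, x ≠ sL0 → x ≠ sA → (1 ≤ x 0 ∧ |x 1| ≤ 1) ∨ x = sB := by decide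
/-- `int_wGm`. [cite: Hammond2015SAPJoining, §4.1 p. 18 (Madras' local modification: one or two edges removed, nine or ten added; arXiv v5)] -/
private theorem int_wGm : ∀ x ∈ wGm.support, x ≠ sL0 → x ≠ sC → (1 ≤ x 0 ∧ |x 1| ≤ 1) ∨ x = sB := by decide
/-- `int_wG3u`. [cite: Hammond2015SAPJoining, §4.1 p. 18 (Madras' local modification: one or two edges removed, nine or ten added; arXiv v5)] -/
private theorem int_wG3u : ∀ x ∈ wG3u.support, x ≠ sL0 → x ≠ sLm → (1 ≤ x 0 ∧ |x 1| ≤ 1) ∨ x = sB ∨ x = sC := by decide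
/-- `int_wG1u`. [cite: Hammond2015SAPJoining, §4.1 p. 18 (Madras' local modification: one or two edges removed, nine or ten added; arXiv v5)] -/
private theorem int_wG1u : ∀ x ∈ wG1u.support, x ≠ sLp → x ≠ sA → (1 ≤ x 0 ∧ |x 1| ≤ 1) ∨ x = sB ∨ x = sL0 := by decide
/-- `int_wG3d`. [cite: Hammond2015SAPJoining, §4.1 p. 18 (Madras' local modification: one or two edges removed, nine or ten added; arXiv v5)] -/
private theorem int_wG3d : ∀ x ∈ wG3d.support, x ≠ sL0 → x ≠ sLp → (1 ≤ x 0 ∧ |x 1| ≤ 1) ∨ x = sB ∨ x = sA := by decide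
/-- `int_wG1d`. [cite: Hammond2015SAPJoining, §4.1 p. 18 (Madras' local modification: one or two edges removed, nine or ten added; arXiv v5)] -/
private theorem int_wG1d : ∀ x ∈ wG1d.support, x ≠ sLm → x ≠ sC → (1 ≤ x 0 ∧ |x 1| ≤ 1) ∨ x = sB ∨ x = sL0 := by decide

/-- `not_in_edge_of_not_vert`. [cite: Hammond2015SAPJoining, §4.1 p. 18 (Madras' local modification: one or two edges removed, nine or ten added; arXiv v5)] -/
private theorem not_in_edge_of_not_vert {x : Site 2} (hx : x ∉ vertsOf τ) : ∀ e ∈ τ, x ∉ e :=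
  fun e he hxe => hx (mem_vertsOf.2 ⟨e, he, hxe⟩)

/-- `not_in_edge_of_corridor`. [cite: Hammond2015SAPJoining, §4.1 p. 18 (Madras' local modification: one or two edges removed, nine or ten added; arXiv v5)] -/
private theorem not_in_edge_of_corridor (hC : CapHyp τ 0) {x : Site 2} (h : 1 ≤ x 0 ∧ |x 1| ≤ 1) : ∀ e ∈ τ, x ∉ e :=
  not_in_edge_of_not_vert (not_vert_of_corridor hC h.1 h.2)

/-- **(i) the capped set is a polygon with `#τ + 8` edges.** [cite: Hammond2015SAPJoining, §4.1 p. 18 (Madras' local modification: one or two edges removed, nine or ten added; arXiv v5)] -/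
theorem cap₀_isPolygon (hτ : IsPolygon (zdGraph 2) τ) (hC : CapHyp τ 0) :
    IsPolygon (zdGraph 2) (cap₀ τ) ∧ (cap₀ τ).card = τ.card + 8 := by
  have hF := br_spec hτ hC
  unfold cap₀
  generalize hb : br τ = β
  rw [hb] at hF
  cases β
  · -- Aup
    have h := reroute_one hτ hF wAup_isPath (by decide) fun x hx h1 h2 =>
      not_in_edge_of_corridor hC (int_wAup x hx h1 h2)
    exact ⟨h.1, by have := h.2; simp only [Br.rem, Br.A]; rw [show wAup.length = 9 by decide] at this; omega⟩
  · -- Adn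
    have h := reroute_one hτ hF wAdn_isPath (by decide) fun x hx h1 h2 =>
      not_in_edge_of_corridor hC (int_wAdn x hx h1 h2)
    exact ⟨h.1, by have := h.2; simp only [Br.rem, Br.A]; rw [show wAdn.length = 9 by decide] at this; omega⟩
  · -- G1u
    obtain ⟨h1, -, hb', hL0⟩ := hF
    have h := reroute_one hτ h1 wG1u_isPath (by decide) fun x hx hx1 hx2 => by
      rcases int_wG1u x hx hx1 hx2 with h | rfl | rfl
      · exact not_in_edge_of_corridor hC h
      · exact not_in_edge_of_not_vert hb'
      · exact not_in_edge_of_not_vert hL0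
    exact ⟨h.1, by have := h.2; simp only [Br.rem, Br.A]; rw [show wG1u.length = 9 by decide] at this; omega⟩
  · -- G2u
    obtain ⟨h1, h2, hb', hdeg⟩ := hF
    have h := reroute_two hτ h1 h2 (by decide) hdeg wG2u_isPath (by decide) fun x hx hx1 hx2 => by
      rcases int_wG2u x hx hx1 hx2 with h | rfl
      · exact not_in_edge_of_corridor hC h
      · exact not_in_edge_of_not_vert hb'
    exact ⟨h.1, by have := h.2; simp only [Br.rem, Br.A]; rw [show wG2u.length = 10 by decide] at this; omega⟩
  · -- G3u
    obtain ⟨h1, -, hb', hc⟩ := hF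
    have h := reroute_one hτ h1 wG3u_isPath (by decide) fun x hx hx1 hx2 => by
      rcases int_wG3u x hx hx1 hx2 with h | rfl | rfl
      · exact not_in_edge_of_corridor hC h
      · exact not_in_edge_of_not_vert hb'
      · exact not_in_edge_of_not_vert hc
    exact ⟨h.1, by have := h.2; simp only [Br.rem, Br.A]; rw [show wG3u.length = 9 by decide] at this; omega⟩
  · -- G3pu
    obtain ⟨h1, h2, hb', hdeg⟩ := hF
    have h := reroute_two hτ h1 h2 (by decide) hdeg wGm_isPath (by decide) fun x hx hx1 hx2 => by
      rcases int_wGm x hx hx1 hx2 with h | rfl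
      · exact not_in_edge_of_corridor hC h
      · exact not_in_edge_of_not_vert hb'
    exact ⟨h.1, by have := h.2; simp only [Br.rem, Br.A]; rw [show wGm.length = 10 by decide] at this; omega⟩
  · -- G1d
    obtain ⟨h1, -, hb', hL0⟩ := hF
    have h := reroute_one hτ h1 wG1d_isPath (by decide) fun x hx hx1 hx2 => by
      rcases int_wG1d x hx hx1 hx2 with h | rfl | rfl
      · exact not_in_edge_of_corridor hC h
      · exact not_in_edge_of_not_vert hb'
      · exact not_in_edge_of_not_vert hL0
    exact ⟨h.1, by have := h.2; simp only [Br.rem, Br.A]; rw [show wG1d.length = 9 by decide] at this; omega⟩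
  · -- G2d
    obtain ⟨h1, h2, hb', hdeg⟩ := hF
    have h := reroute_two hτ h1 h2 (by decide) hdeg wGm_isPath (by decide) fun x hx hx1 hx2 => by
      rcases int_wGm x hx hx1 hx2 with h | rfl
      · exact not_in_edge_of_corridor hC h
      · exact not_in_edge_of_not_vert hb'
    exact ⟨h.1, by have := h.2; simp only [Br.rem, Br.A]; rw [show wGm.length = 10 by decide] at this; omega⟩
  · -- G3d
    obtain ⟨h1, -, hb', ha⟩ := hF
    have h := reroute_one hτ h1 wG3d_isPath (by decide) fun x hx hx1 hx2 => by
      rcases int_wG3d x hx hx1 hx2 with h | rfl | rfl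
      · exact not_in_edge_of_corridor hC h
      · exact not_in_edge_of_not_vert hb'
      · exact not_in_edge_of_not_vert ha
    exact ⟨h.1, by have := h.2; simp only [Br.rem, Br.A]; rw [show wG3d.length = 9 by decide] at this; omega⟩

/-- (ii) `ext₀ ∈ {2, 3}`. [cite: Hammond2015SAPJoining, §4.1 p. 18 (Madras' local modification: one or two edges removed, nine or ten added; arXiv v5)] -/
theorem ext₀_cases (τ : Finset (Sym2 (Site 2))) : ext₀ τ = 2 ∨ ext₀ τ = 3 := by
  unfold ext₀; cases br τ <;> simp [Br.ext]

/-- the two marked edges of the facing 2-segment are detour edges. [cite: Hammond2015SAPJoining, §4.1 p. 18 (Madras' local modification: one or two edges removed, nine or ten added; arXiv v5)] -/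
private theorem Br.marked (β : Br) : s((![β.ext, -1] : Site 2), ![β.ext, 0]) ∈ β.A ∧ s((![β.ext, 0] : Site 2), ![β.ext, 1]) ∈ β.A := by
  cases β <;> decide

/-- (iii) the marked edges belong to the capped set. [cite: Hammond2015SAPJoining, §4.1 p. 18 (Madras' local modification: one or two edges removed, nine or ten added; arXiv v5)] -/
theorem cap₀_marked (τ : Finset (Sym2 (Site 2))) :
    s((![ext₀ τ, -1] : Site 2), ![ext₀ τ, 0]) ∈ cap₀ τ ∧ s((![ext₀ τ, 0] : Site 2), ![ext₀ τ, 1]) ∈ cap₀ τ :=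
  ⟨Finset.mem_union_right _ (br τ).marked.1, Finset.mem_union_right _ (br τ).marked.2⟩

/-- the detour vertices lie in columns `≤ ext`. [cite: Hammond2015SAPJoining, §4.1 p. 18 (Madras' local modification: one or two edges removed, nine or ten added; arXiv v5)] -/
private theorem Br.support_le (β : Br) : ∀ v ∈ vertsOf β.A, v 0 ≤ β.ext := by
  cases β
  · exact fun v hv => by have := mem_support_of_mem_vertsOf _ hv; revert v; decide
  · exact fun v hv => by have := mem_support_of_mem_vertsOf _ hv; revert v; decide
  · exact fun v hv => by have := mem_support_of_mem_vertsOf _ hv; revert v; decide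
  · exact fun v hv => by have := mem_support_of_mem_vertsOf _ hv; revert v; decide
  · exact fun v hv => by have := mem_support_of_mem_vertsOf _ hv; revert v; decide
  · exact fun v hv => by have := mem_support_of_mem_vertsOf _ hv; revert v; decide
  · exact fun v hv => by have := mem_support_of_mem_vertsOf _ hv; revert v; decide
  · exact fun v hv => by have := mem_support_of_mem_vertsOf _ hv; revert v; decide
  · exact fun v hv => by have := mem_support_of_mem_vertsOf _ hv; revert v; decide

/-- `Br.rem_subset`. [cite: Hammond2015SAPJoining, §4.1 p. 18 (Madras' local modification: one or two edges removed, nine or ten added; arXiv v5)] -/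
private theorem Br.rem_subset (β : Br) (τ : Finset (Sym2 (Site 2))) : β.rem τ ⊆ τ := fun _ he => (Br.mem_rem.1 he).1

/-- (iv) the corridor clause: corridor-row vertices of the capped set lie in columns `≤ ext`. [cite: Hammond2015SAPJoining, §4.1 p. 18 (Madras' local modification: one or two edges removed, nine or ten added; arXiv v5)] -/
theorem cap₀_corridor (hC : CapHyp τ 0) : ∀ v ∈ vertsOf (cap₀ τ), |v 1| ≤ 1 → v 0 ≤ ext₀ τ := by
  intro v hv hrow
  rw [cap₀, vertsOf_union, Finset.mem_union] at hv
  rcases hv with hv | hv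
  · have hvτ := vertsOf_mono ((br τ).rem_subset τ) hv
    have : v 0 ≤ 0 := by
      by_contra hlt
      exact not_vert_of_corridor hC (by omega) hrow hvτ
    rcases ext₀_cases τ with h | h <;> omega
  · exact (br τ).support_le v hv

/-- removed and added edges live in the window region `{x ≥ -1} × {|y| ≤ 1}`. [cite: Hammond2015SAPJoining, §4.1 p. 18 (Madras' local modification: one or two edges removed, nine or ten added; arXiv v5)] -/
private theorem Br.window (β : Br) : ∀ e ∈ β.R ∪ β.A, ∀ v ∈ Sym2.toFinset e, -1 ≤ v 0 ∧ |v 1| ≤ 1 := by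
  cases β <;> decide

/-- (v) the window clause. [cite: Hammond2015SAPJoining, §4.1 p. 18 (Madras' local modification: one or two edges removed, nine or ten added; arXiv v5)] -/
theorem cap₀_window (τ : Finset (Sym2 (Site 2))) (e : Sym2 (Site 2)) :
    (e ∈ cap₀ τ ↔ e ∈ τ) ∨ (∀ v ∈ (e : Sym2 (Site 2)).toFinset, -1 ≤ v 0 ∧ |v 1| ≤ 1) := by
  by_cases he : e ∈ (br τ).R ∪ (br τ).A
  · exact Or.inr ((br τ).window e he)
  · left
    rw [Finset.mem_union, not_or] at he
    rw [cap₀, Finset.mem_union, Br.mem_rem]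
    tauto

end Clauses

/-! ### (7) Injectivity of the anchored rule -/

section Inj

variable {τ τ' : Finset (Sym2 (Site 2))}

/-- probe edges (each has an endpoint in the corridor, so never an edge of `τ`). [cite: Madras1995LatticeAnimalsExponent, §2 (decoding the join); Hammond2015SAPJoining, §4.1 pp. 18–20 (arXiv v5)] -/
def pr1 : Sym2 (Site 2) := s((![1, 0] : Site 2), ![2, 0])
/-- probe edge `(1,-1)–(1,0)` (a corridor edge of `C7(+1)`/`C9std(+1)`). [cite: Madras1995LatticeAnimalsExponent, §2 (decoding the join); Hammond2015SAPJoining, §4.1 pp. 18–20 (arXiv v5)] -/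
def pr2 : Sym2 (Site 2) := s((![1, -1] : Site 2), ![1, 0])
/-- probe edge `(2,-1)–(2,0)` (a corridor edge of `C9alt(+1)`/`C7`). [cite: Madras1995LatticeAnimalsExponent, §2 (decoding the join); Hammond2015SAPJoining, §4.1 pp. 18–20 (arXiv v5)] -/
def pr3 : Sym2 (Site 2) := s((![2, -1] : Site 2), ![2, 0])

/-- `pr1_not_mem`. [cite: Madras1995LatticeAnimalsExponent, §2 (decoding the join); Hammond2015SAPJoining, §4.1 pp. 18–20 (arXiv v5)] -/
private theorem pr1_not_mem (hC : CapHyp τ 0) : pr1 ∉ τ := not_mem_of_corridor_left hC (by simp) (by simp)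
/-- `pr2_not_mem`. [cite: Madras1995LatticeAnimalsExponent, §2 (decoding the join); Hammond2015SAPJoining, §4.1 pp. 18–20 (arXiv v5)] -/
private theorem pr2_not_mem (hC : CapHyp τ 0) : pr2 ∉ τ := not_mem_of_corridor_left hC (by simp) (by simp)
/-- `pr3_not_mem`. [cite: Madras1995LatticeAnimalsExponent, §2 (decoding the join); Hammond2015SAPJoining, §4.1 pp. 18–20 (arXiv v5)] -/
private theorem pr3_not_mem (hC : CapHyp τ 0) : pr3 ∉ τ := not_mem_of_corridor_left hC (by simp) (by simp)

/-- the probe signature of a branch. [cite: Madras1995LatticeAnimalsExponent, §2 (decoding the join); Hammond2015SAPJoining, §4.1 pp. 18–20 (arXiv v5)] -/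
def Br.sig (β : Br) : Bool × Bool × Bool := (decide (pr1 ∈ β.A), decide (pr2 ∈ β.A), decide (pr3 ∈ β.A))

/-- classes of branches with the same `(R, A)`: `G3pu ~ G2d`. [cite: Madras1995LatticeAnimalsExponent, §2 (decoding the join); Hammond2015SAPJoining, §4.1 pp. 18–20 (arXiv v5)] -/
def Br.cls : Br → ℕ
  | .Aup => 0 | .Adn => 1 | .G1u => 2 | .G2u => 3 | .G3u => 4 | .G3pu => 5 | .G1d => 6 | .G2d => 5 | .G3d => 7

/-- `Br.R_eq_of_cls`. [cite: Madras1995LatticeAnimalsExponent, §2 (decoding the join); Hammond2015SAPJoining, §4.1 pp. 18–20 (arXiv v5)] -/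
private theorem Br.R_eq_of_cls {β β' : Br} (h : β.cls = β'.cls) : β.R = β'.R := by
  cases β <;> cases β' <;> simp [Br.cls] at h <;> rfl

/-- `Br.A_eq_of_cls`. [cite: Madras1995LatticeAnimalsExponent, §2 (decoding the join); Hammond2015SAPJoining, §4.1 pp. 18–20 (arXiv v5)] -/
private theorem Br.A_eq_of_cls {β β' : Br} (h : β.cls = β'.cls) : β.A = β'.A := by
  cases β <;> cases β' <;> simp [Br.cls] at h <;> rfl

/-- the finite fact behind FACT-1: extension and probe signature determine the `(R, A)`-class, except for
the two pairs `{G1u, G3d}` and `{G1d, G3u}` (separated by the edges `aL₊`, `cL₋`). [cite: Madras1995LatticeAnimalsExponent, §2 (decoding the join); Hammond2015SAPJoining, §4.1 pp. 18–20 (arXiv v5)] -/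
private theorem Br.cls_of_sig : ∀ β β' : Br, β.ext = β'.ext → β.sig = β'.sig →
    β.cls = β'.cls ∨ (β = .G1u ∧ β' = .G3d) ∨ (β = .G3d ∧ β' = .G1u) ∨ (β = .G1d ∧ β' = .G3u) ∨ (β = .G3u ∧ β' = .G1d) := by
  decide

/-- `probe_mem_iff`. [cite: Madras1995LatticeAnimalsExponent, §2 (decoding the join); Hammond2015SAPJoining, §4.1 pp. 18–20 (arXiv v5)] -/
private theorem probe_mem_iff {p : Sym2 (Site 2)} (hp : p ∉ τ) : p ∈ cap₀ τ ↔ p ∈ (br τ).A := by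
  rw [cap₀, Finset.mem_union, Br.mem_rem]
  constructor
  · rintro (⟨h, -⟩ | h)
    · exact absurd h hp
    · exact h
  · exact Or.inr

/-- `sig_eq`. [cite: Madras1995LatticeAnimalsExponent, §2 (decoding the join); Hammond2015SAPJoining, §4.1 pp. 18–20 (arXiv v5)] -/
private theorem sig_eq (hC : CapHyp τ 0) (hC' : CapHyp τ' 0) (hJ : cap₀ τ = cap₀ τ') : (br τ).sig = (br τ').sig := by
  have e1 := (probe_mem_iff (pr1_not_mem hC)).symm.trans (hJ ▸ probe_mem_iff (pr1_not_mem hC'))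
  have e2 := (probe_mem_iff (pr2_not_mem hC)).symm.trans (hJ ▸ probe_mem_iff (pr2_not_mem hC'))
  have e3 := (probe_mem_iff (pr3_not_mem hC)).symm.trans (hJ ▸ probe_mem_iff (pr3_not_mem hC'))
  simp only [Br.sig, Prod.mk.injEq]
  exact ⟨by rw [Bool.decide_congr e1], by rw [Bool.decide_congr e2], by rw [Bool.decide_congr e3]⟩

/-- every detour edge has an endpoint off `τ` (a corridor point or a free window site of the branch), so the
detour is edge-disjoint from `τ`. [cite: Madras1995LatticeAnimalsExponent, §2 (decoding the join); Hammond2015SAPJoining, §4.1 pp. 18–20 (arXiv v5)] -/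
private theorem A_not_mem (hτ : IsPolygon (zdGraph 2) τ) (hC : CapHyp τ 0) : ∀ e ∈ (br τ).A, e ∉ τ := by
  have hF := br_spec hτ hC
  generalize hb : br τ = β
  rw [hb] at hF
  -- an endpoint `v` of `e` with `v ∉ vertsOf τ` suffices
  have key : ∀ (S : Site 2 → Prop), (∀ v, S v → v ∉ vertsOf τ) →
      (∀ e ∈ β.A, ∃ v ∈ Sym2.toFinset e, (1 ≤ v 0 ∧ |v 1| ≤ 1) ∨ S v) → ∀ e ∈ β.A, e ∉ τ := by
    intro S hS h e he heτ
    obtain ⟨v, hv, hv'⟩ := h e he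
    rw [Sym2.mem_toFinset] at hv
    have hvτ : v ∈ vertsOf τ := mem_vertsOf.2 ⟨e, heτ, hv⟩
    rcases hv' with h | h
    · exact not_vert_of_corridor hC h.1 h.2 hvτ
    · exact hS v h hvτ
  cases β
  · exact key (fun _ => False) (fun _ h => h.elim) (by decide)
  · exact key (fun _ => False) (fun _ h => h.elim) (by decide)
  · obtain ⟨-, -, hb', hL0⟩ := hF
    exact key (fun v => v = sB ∨ v = sL0) (fun v h => by rcases h with rfl | rfl <;> assumption) (by decide)
  · obtain ⟨-, -, hb', -⟩ := hF
    exact key (fun v => v = sB) (fun v h => by subst h; exact hb') (by decide)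
  · obtain ⟨-, -, hb', hc⟩ := hF
    exact key (fun v => v = sB ∨ v = sC) (fun v h => by rcases h with rfl | rfl <;> assumption) (by decide)
  · obtain ⟨-, -, hb', -⟩ := hF
    exact key (fun v => v = sB) (fun v h => by subst h; exact hb') (by decide)
  · obtain ⟨-, -, hb', hL0⟩ := hF
    exact key (fun v => v = sB ∨ v = sL0) (fun v h => by rcases h with rfl | rfl <;> assumption) (by decide)
  · obtain ⟨-, -, hb', -⟩ := hF
    exact key (fun v => v = sB) (fun v h => by subst h; exact hb') (by decide)
  · obtain ⟨-, -, hb', ha⟩ := hF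
    exact key (fun v => v = sB ∨ v = sA) (fun v h => by rcases h with rfl | rfl <;> assumption) (by decide)

/-- the removed edges are edges of `τ`. [cite: Madras1995LatticeAnimalsExponent, §2 (decoding the join); Hammond2015SAPJoining, §4.1 pp. 18–20 (arXiv v5)] -/
private theorem R_subset (hτ : IsPolygon (zdGraph 2) τ) (hC : CapHyp τ 0) : (br τ).R ⊆ τ := by
  have hF := br_spec hτ hC
  generalize hb : br τ = β
  rw [hb] at hF
  cases β <;> simp only [BrFacts] at hF <;> simp only [Br.R, Finset.insert_subset_iff, Finset.singleton_subset_iff]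
  · exact hF
  · exact hF
  · exact hF.1
  · exact ⟨hF.1, hF.2.1⟩
  · exact hF.1
  · exact ⟨hF.1, hF.2.1⟩
  · exact hF.1
  · exact ⟨hF.1, hF.2.1⟩
  · exact hF.1

/-- `τ` is recovered from its image, the removed set and the detour: `τ = (cap₀ τ ∖ A) ∪ R`. [cite: Madras1995LatticeAnimalsExponent, §2 (decoding the join); Hammond2015SAPJoining, §4.1 pp. 18–20 (arXiv v5)] -/
private theorem tau_eq (hτ : IsPolygon (zdGraph 2) τ) (hC : CapHyp τ 0) : τ = (cap₀ τ \ (br τ).A) ∪ (br τ).R := by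
  ext e
  simp only [Finset.mem_union, Finset.mem_sdiff, cap₀, Br.mem_rem]
  constructor
  · intro he
    by_cases hR : e ∈ (br τ).R
    · exact Or.inr hR
    · exact Or.inl ⟨Or.inl ⟨he, hR⟩, fun hA => A_not_mem hτ hC e hA he⟩
  · rintro (⟨⟨he, -⟩ | hA, hnA⟩ | hR)
    · exact he
    · exact absurd hA hnA
    · exact R_subset hτ hC hR

/-- the separating edges of the two exceptional pairs. [cite: Madras1995LatticeAnimalsExponent, §2 (decoding the join); Hammond2015SAPJoining, §4.1 pp. 18–20 (arXiv v5)] -/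
private theorem aLp_G1u_G3d : s(sLp, sA) ∉ Br.A .G1u ∧ s(sLp, sA) ∈ Br.A .G3d ∧ s(sLp, sA) ∈ Br.R .G1u := by decide
/-- `cLm_G1d_G3u`. [cite: Madras1995LatticeAnimalsExponent, §2 (decoding the join); Hammond2015SAPJoining, §4.1 pp. 18–20 (arXiv v5)] -/
private theorem cLm_G1d_G3u : s(sLm, sC) ∉ Br.A .G1d ∧ s(sLm, sC) ∈ Br.A .G3u ∧ s(sLm, sC) ∈ Br.R .G1d := by decide

/-- `excl_pair`. [cite: Madras1995LatticeAnimalsExponent, §2 (decoding the join); Hammond2015SAPJoining, §4.1 pp. 18–20 (arXiv v5)] -/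
private theorem excl_pair {e : Sym2 (Site 2)}
    (h1 : e ∉ (br τ).A) (h2 : e ∈ (br τ).R) (h3 : e ∈ (br τ').A) (hJ : cap₀ τ = cap₀ τ') : False := by
  have hin : e ∈ cap₀ τ' := Finset.mem_union_right _ h3
  rw [← hJ, cap₀, Finset.mem_union, Br.mem_rem] at hin
  rcases hin with ⟨-, h⟩ | h
  · exact h h2
  · exact h1 h

/-- **injectivity for equal extensions**: `cap₀ τ = cap₀ τ'` and `ext₀ τ = ext₀ τ'` force `τ = τ'`. [cite: Madras1995LatticeAnimalsExponent, §2 (decoding the join); Hammond2015SAPJoining, §4.1 pp. 18–20 (arXiv v5)] -/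
theorem inj_zero (hτ : IsPolygon (zdGraph 2) τ) (hC : CapHyp τ 0) (hτ' : IsPolygon (zdGraph 2) τ') (hC' : CapHyp τ' 0)
    (hext : ext₀ τ = ext₀ τ') (hJ : cap₀ τ = cap₀ τ') : τ = τ' := by
  have hcls := Br.cls_of_sig (br τ) (br τ') hext (sig_eq hC hC' hJ)
  rcases hcls with h | ⟨h1, h2⟩ | ⟨h1, h2⟩ | ⟨h1, h2⟩ | ⟨h1, h2⟩
  · rw [tau_eq hτ hC, tau_eq hτ' hC', hJ, Br.A_eq_of_cls h, Br.R_eq_of_cls h]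
  · exact (excl_pair (h1 ▸ aLp_G1u_G3d.1) (h1 ▸ aLp_G1u_G3d.2.2) (h2 ▸ aLp_G1u_G3d.2.1) hJ).elim
  · exact (excl_pair (h2 ▸ aLp_G1u_G3d.1) (h2 ▸ aLp_G1u_G3d.2.2) (h1 ▸ aLp_G1u_G3d.2.1) hJ.symm).elim
  · exact (excl_pair (h1 ▸ cLm_G1d_G3u.1) (h1 ▸ cLm_G1d_G3u.2.2) (h2 ▸ cLm_G1d_G3u.2.1) hJ).elim
  · exact (excl_pair (h2 ▸ cLm_G1d_G3u.1) (h2 ▸ cLm_G1d_G3u.2.2) (h1 ▸ cLm_G1d_G3u.2.1) hJ.symm).elim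

/-- `br_of_ext_two`. [cite: Madras1995LatticeAnimalsExponent, §2 (decoding the join); Hammond2015SAPJoining, §4.1 pp. 18–20 (arXiv v5)] -/
private theorem br_of_ext_two {τ : Finset (Sym2 (Site 2))} (h2 : ext₀ τ = 2) :
    br τ = .G1u ∨ br τ = .G3u ∨ br τ = .G1d ∨ br τ = .G3d := by
  unfold ext₀ at h2
  generalize hb : br τ = β at h2 ⊢
  cases β <;> simp [Br.ext] at h2 ⊢

/-- in an `ext = 2` branch the image carries a vertical edge leaving the band at column `0` (`a_up` or `c_dn`). [cite: Madras1995LatticeAnimalsExponent, §2 (decoding the join); Hammond2015SAPJoining, §4.1 pp. 18–20 (arXiv v5)] -/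
private theorem vertical_of_ext_two (hτ : IsPolygon (zdGraph 2) τ) (hC : CapHyp τ 0) (h2 : ext₀ τ = 2) :
    s(sA, sAup) ∈ cap₀ τ ∨ s(sC, sCdn) ∈ cap₀ τ := by
  have hF := br_spec hτ hC
  have hnotR : s(sA, sAup) ∉ (br τ).R ∧ s(sC, sCdn) ∉ (br τ).R := by cases br τ <;> decide
  have memA : s(sA, sAup) ∈ τ → s(sA, sAup) ∈ cap₀ τ := fun h =>
    Finset.mem_union_left _ (Br.mem_rem.2 ⟨h, hnotR.1⟩)
  have memC : s(sC, sCdn) ∈ τ → s(sC, sCdn) ∈ cap₀ τ := fun h =>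
    Finset.mem_union_left _ (Br.mem_rem.2 ⟨h, hnotR.2⟩)
  rcases br_of_ext_two h2 with h | h | h | h <;> rw [h] at hF <;> simp only [BrFacts] at hF
  · exact Or.inl (memA hF.2.1)
  · exact Or.inl (memA hF.2.1)
  · exact Or.inr (memC hF.2.1)
  · exact Or.inr (memC hF.2.1)

/-- no detour contains a vertical edge in column `1` leaving the band. [cite: Madras1995LatticeAnimalsExponent, §2 (decoding the join); Hammond2015SAPJoining, §4.1 pp. 18–20 (arXiv v5)] -/
private theorem Br.no_col_one_vertical (β : Br) :
    s((![1, 1] : Site 2), ![1, 2]) ∉ β.A ∧ s((![1, -1] : Site 2), ![1, -2]) ∉ β.A := by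
  cases β <;> decide

/-- **different extensions are impossible**: an `ext = 3` image is never the unit right-translate of an
`ext = 2` image (FACT-2: the band-leaving vertical edge at column `X − 2`). [cite: Madras1995LatticeAnimalsExponent, §2 (decoding the join); Hammond2015SAPJoining, §4.1 pp. 18–20 (arXiv v5)] -/
theorem no_shift_one (hC : CapHyp τ 0) (hτ' : IsPolygon (zdGraph 2) τ') (hC' : CapHyp τ' 0)
    (h2 : ext₀ τ' = 2) (hJ : cap₀ τ = shiftEdges (xsh 1) (cap₀ τ')) : False := by
  have key : ∀ {e : Sym2 (Site 2)} {p q : Site 2}, e ∈ cap₀ τ' → shE (xsh 1) e = s(p, q) → 1 ≤ p 0 → |p 1| ≤ 1 →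
      s(p, q) ∉ (br τ).A → False := by
    intro e p q hm he h0 h1 hA
    have : s(p, q) ∈ cap₀ τ := by
      rw [hJ, ← he]; exact (mem_shiftEdges (t := xsh 1)).2 hm
    rw [cap₀, Finset.mem_union, Br.mem_rem] at this
    rcases this with ⟨h, -⟩ | h
    · exact not_mem_of_corridor_left hC h0 h1 h
    · exact hA h
  rcases vertical_of_ext_two hτ' hC' h2 with h | h
  · exact key (p := ![1, 1]) (q := ![1, 2]) h (by decide) (by simp) (by simp) (br τ).no_col_one_vertical.1
  · exact key (p := ![1, -1]) (q := ![1, -2]) h (by decide) (by simp) (by simp) (br τ).no_col_one_vertical.2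

/-- `xsh_zero_eq`. [cite: Madras1995LatticeAnimalsExponent, §2 (decoding the join); Hammond2015SAPJoining, §4.1 pp. 18–20 (arXiv v5)] -/
private theorem xsh_zero_eq : xsh 0 = 0 := by funext i; fin_cases i <;> rfl

/-- **`cap₀` satisfies `AnchoredSpec`.** [cite: Madras1995LatticeAnimalsExponent, §2 (decoding the join); Hammond2015SAPJoining, §4.1 pp. 18–20 (arXiv v5)] -/
theorem anchoredSpec_cap₀ : AnchoredSpec cap₀ ext₀ := by
  refine ⟨fun τ hτ hC => ?_, fun τ τ' d hτ hC hτ' hC' hext hJ => ?_⟩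
  · obtain ⟨hP, hcard⟩ := cap₀_isPolygon hτ hC
    exact ⟨hP, hcard, ext₀_cases τ, (cap₀_marked τ).1, (cap₀_marked τ).2, cap₀_corridor hC, cap₀_window τ⟩
  · have hd : d = 0 ∨ d = 1 ∨ d = -1 := by
      rcases ext₀_cases τ with h | h <;> rcases ext₀_cases τ' with h' | h' <;> omega
    rcases hd with rfl | rfl | rfl
    · rw [xsh_zero_eq, shiftEdges_zero] at hJ ⊢
      exact inj_zero hτ hC hτ' hC' (by omega) hJ
    · have h2 : ext₀ τ' = 2 := by rcases ext₀_cases τ with h | h <;> rcases ext₀_cases τ' with h' | h' <;> omega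
      exact (no_shift_one hC hτ' hC' h2 hJ).elim
    · have h2 : ext₀ τ = 2 := by rcases ext₀_cases τ with h | h <;> rcases ext₀_cases τ' with h' | h' <;> omega
      have hJ' : cap₀ τ' = shiftEdges (xsh 1) (cap₀ τ) := by
        rw [hJ, shiftEdges_shiftEdges]
        have : xsh (-1) + xsh 1 = 0 := by funext i; fin_cases i <;> rfl
        rw [this, shiftEdges_zero]
      exact (no_shift_one hC' hτ hC h2 hJ').elim

end Inj

/-! ### (8) Assembly: `CapGadget` holds -/

/-- **S2 holds**: the cap gadget `anchoredCap cap₀` / `anchoredExt ext₀`. [cite: Hammond2015SAPJoining, §4.1 pp. 17–20 (arXiv v5)] -/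
theorem capGadget : CapGadget :=
  ⟨anchoredCap cap₀, anchoredExt ext₀, capSpec_of_anchored anchoredSpec_cap₀⟩

/-- **S2** `CapGadget`, discharged under the exact `<Fact>_holds` name that the tree's named-fact accounting keys on
(the same proof as `capGadget`). [cite: Hammond2015SAPJoining, §4.1 p. 18 and Figure 2 p. 19 (Madras' local modification; arXiv v5)] -/
theorem CapGadget_holds : CapGadget := capGadget

end Literature.Probability.RandomPlanarGeometry.SAW.JoinParity
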